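import Literature.Analysis.FluidPDE.SteadyLiouvilleTsaiVorticity
import Literature.Analysis.FluidPDE.PressureGradientInterior
import HarnessLib
import Mathlib.MeasureTheory.Measure.Haar.NormedSpace

/-!
# Tsai's annular Liouville theorem (Tsai 2021, Thm 1.1 (a)) — III: the pressure-independent
# interior estimate on spherical shells

Analysis/FluidPDE support file (theorems only: no definitions, no named facts) on the discharge
path of the named fact `Literature.Analysis.FluidPDE.Tsai2021_annular_liouville`
(`SteadyLiouvilleCriteria.lean`; T.-P. Tsai, SN Partial Differ. Equ. Appl. 2 (2021), Paper
No. 10 = arXiv:2005.09691, Theorem 1.1 (a)), sequel of `SteadyLiouvilleTsaiKit.lean` and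
`SteadyLiouvilleTsaiVorticity.lean`.

The key to Tsai's theorem is the local pressure estimate (Lemma 3.2, display (3.5)):
`‖p − (p)_A‖_{L^{q/2}(A_R)} ≤ Cσ⁻²R⁻¹‖u‖_{L^{q/2}(Â_R)} + Cσ⁻¹‖u‖²_{L^q(Â_R)}` on annuli, printed
as a consequence of the pressure-independent interior Stokes estimate of Šverák–Tsai (Lemma 3.1)
and a Bogovskiĭ map on thin annuli (Lemma 2.3). With the radii ratio `L` FIXED (which is all
that Theorem 1.1 (a) needs) the tree proves it without Bogovskiĭ's operator:

* §1 more kit (sup bounds, conjugate exponents, kernels from `λ`; sums through `N` are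
  `eLpNorm_newtonNearPotential_sum_le` of `PressureGradientInterior.lean`);
* §2 the stress `T_{ij} = ν(∂ⱼUᵢ − ∂ᵢUⱼ) − UᵢUⱼ` with `∂ᵢP = Σⱼ∂ⱼT_{ij}`, `ΔP = Σᵢⱼ∂ᵢ∂ⱼT_{ij}`;
* §3 **Step 3** `pressure_gradient_bound`: the local pressure `p₁ = N[Σᵢⱼ∂ᵢ∂ⱼ(χT_{ij})]` has
  `‖p₁‖_p ≤ CB` (Calderón–Zygmund) and `sup_A |∇(P − p₁)| ≤ CB`,
  `B = ‖U‖_{L^p(K)} + ‖U‖²_{L^{2p}(K)}`, by Green's representation at scale `r₁` applied to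
  `∂ₖ(P − p₁)` (on the plateau of `χ`, `Δ(P − p₁) = Λ[τ]` is an explicit smoothing of `χT`);
* §4 geometry: the oscillation of a `C¹` function over a spherical shell is at most `9b sup‖∇‖`
  (radius plus great-circle arc);
* §5 smooth shell cut-offs; §6 `pressure_osc_shell` (unit scale): some constant `c` has
  `‖P − c‖_{L^p(a₂≤|x|≤b₂)} ≤ C(‖U‖_{L^p(a₁<|x|<b₁)} + ‖U‖²_{L^{2p}(a₁<|x|<b₁)})`;
* §7 scaling `x ↦ Rx` (`isLerayProfile_scale`, change of variables in `L^p` over shells) and the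
  form consumed by the energy estimate, `pressure_osc_shell_scaled`:
  `‖P − c‖_{L^p(a₂R≤|x|≤b₂R)} ≤ C(R⁻¹‖U‖_{L^p(a₁R<|x|<b₁R)} + ‖U‖²_{L^{2p}(a₁R<|x|<b₁R)})`,
  `C` independent of `R > 0` and of the solution — Tsai's (3.5) with `q/2 = p`.

## References

* T.-P. Tsai, SN Partial Differ. Equ. Appl. 2 (2021), Paper No. 10 (arXiv:2005.09691), §2
  (Lemmas 2.2–2.3), §3 (Lemmas 3.1–3.2, (3.5)). [Tsai2021]
* V. Šverák, T.-P. Tsai, *On the spatial decay of 3-D steady-state Navier–Stokes flows*, Comm.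
  PDE 25 (2000) 2107–2117 (the pressure-independent interior estimate). 
-/

noncomputable section

open MeasureTheory Set Filter Function Metric InnerProductSpace Topology
open scoped ENNReal NNReal RealInnerProductSpace Laplacian ContDiff Convolution

namespace Literature.Analysis.FluidPDE

namespace Tsai2021

/-! ### §1. More kit: sums through `N`, sup bounds, conjugate exponents, kernels from `λ` -/

section MoreKit

variable {r₀ r₁ : ℝ} {p : ℝ≥0∞}

/-- **Sup bound for `N` of a bounded density**: `|N[g](x)| ≤ ‖Γ₀‖₁ sup|g|`. [folklore] -/
theorem enorm_newtonNearPotential_le_of_bound (r₀ r₁ : ℝ) {g : (EuclideanSpace ℝ (Fin 3)) → ℝ} {S : ℝ≥0∞}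
    (hg : ∀ y, ‖g y‖ₑ ≤ S) (x : (EuclideanSpace ℝ (Fin 3))) :
    ‖newtonNearPotential r₀ r₁ g x‖ₑ ≤ (∫⁻ z, ‖newtonNear r₀ r₁ z‖ₑ) * S := by
  rw [newtonNearPotential_apply]
  calc ‖∫ z, newtonNear r₀ r₁ z * g (x - z)‖ₑ ≤ ∫⁻ z, ‖newtonNear r₀ r₁ z * g (x - z)‖ₑ :=
        enorm_integral_le_lintegral_enorm _
    _ ≤ ∫⁻ z, ‖newtonNear r₀ r₁ z‖ₑ * S := lintegral_mono fun z => by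
        rw [enorm_mul]; gcongr; exact hg _
    _ = (∫⁻ z, ‖newtonNear r₀ r₁ z‖ₑ) * S :=
        lintegral_mul_const S (measurable_newtonNear r₀ r₁).enorm

/-- The conjugate exponent of `1 ≤ p`: `q = (1 − p⁻¹)⁻¹` satisfies `q⁻¹ + p⁻¹ = 1`. [folklore] -/
theorem holderTriple_conj (hp : 1 ≤ p) : ENNReal.HolderTriple (1 - p⁻¹)⁻¹ p 1 := by
  refine ENNReal.holderConjugate_iff.2 ?_
  rw [inv_inv, tsub_add_cancel_of_le]
  exact ENNReal.inv_le_one.2 hp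

/-- A continuous compactly supported kernel has finite `L^q` norm. [folklore] -/
theorem eLpNorm_lt_top_of_hasCompactSupport {k : (EuclideanSpace ℝ (Fin 3)) → ℝ} (hk : Continuous k)
    (hkc : HasCompactSupport k) (q : ℝ≥0∞) : eLpNorm k q volume < ⊤ :=
  (hk.memLp_of_hasCompactSupport hkc).eLpNorm_lt_top

/-- **Pointwise Hölder bound for a kernel integral** in the form used below: if
`‖k‖_q ≤ Kq` then `|∫ k(z) g(x − z) dz| ≤ Kq ‖g‖_p`. [folklore] -/
theorem enorm_integral_mul_comp_sub_le' (hp : 1 ≤ p) {k g : (EuclideanSpace ℝ (Fin 3)) → ℝ} (hk : Continuous k)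
    (hg : Continuous g) {Kq : ℝ≥0∞} (hKq : eLpNorm k (1 - p⁻¹)⁻¹ volume ≤ Kq) (x : (EuclideanSpace ℝ (Fin 3))) :
    ‖∫ z, k z * g (x - z)‖ₑ ≤ Kq * eLpNorm g p volume := by
  haveI := holderTriple_conj hp
  exact (enorm_integral_mul_comp_sub_le hk.aestronglyMeasurable hg.aestronglyMeasurable x).trans
    (mul_le_mul' hKq le_rfl)

/-- Moving three derivatives from the density onto a smooth compactly supported kernel:
`∫ k(z) ∂ₐ∂_b∂_c g(x − z) dz = ∫ (∂_c∂_b∂ₐ k)(z) g(x − z) dz`. [folklore] -/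
theorem integral_mul_pd_pd_pd_comp_sub {k : (EuclideanSpace ℝ (Fin 3)) → ℝ} (hk : ContDiff ℝ ∞ k) (hkc : HasCompactSupport k)
    {g : (EuclideanSpace ℝ (Fin 3)) → ℝ} (hg : ContDiff ℝ ∞ g) (x a b c : (EuclideanSpace ℝ (Fin 3))) :
    ∫ z, k z * fderiv ℝ (fun y₁ => fderiv ℝ (fun y₂ => fderiv ℝ g y₂ c) y₁ b) (x - z) a =
      ∫ z, fderiv ℝ (fun z₁ => fderiv ℝ (fun z₂ => fderiv ℝ k z₂ a) z₁ b) z c * g (x - z) := by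
  have hk1 : ContDiff ℝ 1 k := hk.of_le (by norm_cast)
  have hka : ContDiff ℝ ∞ fun z => fderiv ℝ k z a := contDiff_pd hk a
  have hkab : ContDiff ℝ ∞ fun z₁ => fderiv ℝ (fun z₂ => fderiv ℝ k z₂ a) z₁ b := contDiff_pd hka b
  have hgc' : ContDiff ℝ ∞ fun y => fderiv ℝ g y c := contDiff_pd hg c
  have hgcb : ContDiff ℝ ∞ fun y₁ => fderiv ℝ (fun y₂ => fderiv ℝ g y₂ c) y₁ b := contDiff_pd hgc' b
  rw [integral_mul_pd_comp_sub k hk1 hkc (hgcb.of_le (by norm_cast)) x a,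
    integral_mul_pd_comp_sub _ (hka.of_le (by norm_cast)) (hasCompactSupport_pd hkc a)
      (hgc'.of_le (by norm_cast)) x b,
    integral_mul_pd_comp_sub _ (hkab.of_le (by norm_cast))
      (hasCompactSupport_pd (hasCompactSupport_pd hkc a) b) (hg.of_le (by norm_cast)) x c]

/-- `‖ℓ‖ ≤ Σₖ |ℓ(eₖ)|` for a functional on `(EuclideanSpace ℝ (Fin 3))`. [folklore] -/
theorem opNorm_le_sum_abs (ℓ : (EuclideanSpace ℝ (Fin 3)) →L[ℝ] ℝ) : ‖ℓ‖ ≤ ∑ k : Fin 3, |ℓ ((EuclideanSpace.single (k : Fin 3) (1 : ℝ)))| := by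
  refine ContinuousLinearMap.opNorm_le_bound _ (Finset.sum_nonneg fun k _ => abs_nonneg _)
    fun v => ?_
  have hv : ℓ v = ∑ k : Fin 3, v k * ℓ ((EuclideanSpace.single (k : Fin 3) (1 : ℝ))) := by
    conv_lhs => rw [eq_sum_single v]
    rw [map_sum]
    exact Finset.sum_congr rfl fun k _ => by rw [map_smul, smul_eq_mul]
  rw [hv, Finset.sum_mul]
  refine (norm_sum_le _ _).trans (Finset.sum_le_sum fun k _ => ?_)
  rw [norm_mul, Real.norm_eq_abs, Real.norm_eq_abs, mul_comm]
  gcongr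
  simpa using PiLp.norm_apply_le v k

end MoreKit

/-! ### §2. The stress `T_{ij} = ν(∂ⱼUᵢ − ∂ᵢUⱼ) − UᵢUⱼ` carries the pressure gradient -/

section Stress

variable {ν : ℝ} {U : (EuclideanSpace ℝ (Fin 3)) → (EuclideanSpace ℝ (Fin 3))} {P : (EuclideanSpace ℝ (Fin 3)) → ℝ}

/-- **`∂ᵢP = Σⱼ ∂ⱼT_{ij}`** with `T_{ij} = ν(∂ⱼUᵢ − ∂ᵢUⱼ) − UᵢUⱼ`: indeed
`Σⱼ∂ⱼT_{ij} = νΔUᵢ − ν∂ᵢ(div U) − Σⱼ∂ⱼ(UᵢUⱼ) = ∂ᵢP` by the system in coordinates and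
`div U = 0`. [cite: Tsai2021, §3 (the system as a Stokes system with F = −u⊗u)] -/
theorem pressure_pd_eq_sum (hprof : IsLerayProfile ν 0 U P) (hU : ContDiff ℝ ∞ U) (x : (EuclideanSpace ℝ (Fin 3)))
    (i : Fin 3) :
    fderiv ℝ P x ((EuclideanSpace.single (i : Fin 3) (1 : ℝ))) = ∑ j : Fin 3, fderiv ℝ (fun y =>
      ν * (fderiv ℝ (fun z => U z i) y ((EuclideanSpace.single (j : Fin 3) (1 : ℝ))) - fderiv ℝ (fun z => U z j) y ((EuclideanSpace.single (i : Fin 3) (1 : ℝ)))) - U y i * U y j)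
        x ((EuclideanSpace.single (j : Fin 3) (1 : ℝ))) := by
  have hUi : ∀ k : Fin 3, ContDiff ℝ ∞ fun y => U y k := fun k => contDiff_euclidean.1 hU k
  have hF : ∀ k l : Fin 3, ContDiff ℝ ∞ fun y => U y k * U y l := fun k l => (hUi k).mul (hUi l)
  have hd : ∀ (k l : Fin 3), ContDiff ℝ ∞ fun y => fderiv ℝ (fun z => U z k) y ((EuclideanSpace.single (l : Fin 3) (1 : ℝ))) := fun k l =>
    contDiff_pd (hUi k) _
  -- expand the derivative of `T_{ij}`
  have hexp : ∀ j : Fin 3, fderiv ℝ (fun y =>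
      ν * (fderiv ℝ (fun z => U z i) y ((EuclideanSpace.single (j : Fin 3) (1 : ℝ))) - fderiv ℝ (fun z => U z j) y ((EuclideanSpace.single (i : Fin 3) (1 : ℝ)))) - U y i * U y j) x ((EuclideanSpace.single (j : Fin 3) (1 : ℝ)))
      = ν * (fderiv ℝ (fun y => fderiv ℝ (fun z => U z i) y ((EuclideanSpace.single (j : Fin 3) (1 : ℝ)))) x ((EuclideanSpace.single (j : Fin 3) (1 : ℝ)))
          - fderiv ℝ (fun y => fderiv ℝ (fun z => U z j) y ((EuclideanSpace.single (i : Fin 3) (1 : ℝ)))) x ((EuclideanSpace.single (j : Fin 3) (1 : ℝ))))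
        - fderiv ℝ (fun y => U y i * U y j) x ((EuclideanSpace.single (j : Fin 3) (1 : ℝ))) := by
    intro j
    have h1 : DifferentiableAt ℝ (fun y => fderiv ℝ (fun z => U z i) y ((EuclideanSpace.single (j : Fin 3) (1 : ℝ)))) x :=
      (hd i j).differentiable (by norm_cast) x
    have h2 : DifferentiableAt ℝ (fun y => fderiv ℝ (fun z => U z j) y ((EuclideanSpace.single (i : Fin 3) (1 : ℝ)))) x :=
      (hd j i).differentiable (by norm_cast) x
    have h3 : DifferentiableAt ℝ (fun y => U y i * U y j) x := (hF i j).differentiable (by norm_cast) x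
    have h12 : DifferentiableAt ℝ (fun y => fderiv ℝ (fun z => U z i) y ((EuclideanSpace.single (j : Fin 3) (1 : ℝ)))
        - fderiv ℝ (fun z => U z j) y ((EuclideanSpace.single (i : Fin 3) (1 : ℝ)))) x := h1.sub h2
    have h12ν : DifferentiableAt ℝ (fun y => ν * (fderiv ℝ (fun z => U z i) y ((EuclideanSpace.single (j : Fin 3) (1 : ℝ)))
        - fderiv ℝ (fun z => U z j) y ((EuclideanSpace.single (i : Fin 3) (1 : ℝ))))) x := h12.const_mul ν
    rw [fderiv_fun_sub h12ν h3, fderiv_const_mul h12 ν, fderiv_fun_sub h1 h2]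
    simp only [FunLike.coe_sub, Pi.sub_apply, FunLike.coe_smul, Pi.smul_apply, smul_eq_mul]
  simp only [hexp, Finset.sum_sub_distrib, ← Finset.mul_sum]
  -- `Σⱼ ∂ⱼ∂ⱼUᵢ = ΔUᵢ`, `Σⱼ ∂ⱼ∂ᵢUⱼ = ∂ᵢ div U = 0`
  rw [← laplacian_eq_sum_three ((hUi i).of_le (by norm_cast)), mul_sub, component_eq hprof hU x i]
  have hdiv0 : (fun y => ∑ j : Fin 3, fderiv ℝ (fun z => U z j) y ((EuclideanSpace.single (j : Fin 3) (1 : ℝ)))) = fun _ => 0 := by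
    funext y
    rw [← divergence_eq_sum_coord (hU.differentiable (by norm_cast))]
    exact hprof.divFree y
  have hsum0 : ∑ j : Fin 3, fderiv ℝ (fun y => fderiv ℝ (fun z => U z j) y ((EuclideanSpace.single (i : Fin 3) (1 : ℝ)))) x ((EuclideanSpace.single (j : Fin 3) (1 : ℝ))) = 0 := by
    have hcomm : ∀ j : Fin 3, fderiv ℝ (fun y => fderiv ℝ (fun z => U z j) y ((EuclideanSpace.single (i : Fin 3) (1 : ℝ)))) x ((EuclideanSpace.single (j : Fin 3) (1 : ℝ))) =
        fderiv ℝ (fun y => fderiv ℝ (fun z => U z j) y ((EuclideanSpace.single (j : Fin 3) (1 : ℝ)))) x ((EuclideanSpace.single (i : Fin 3) (1 : ℝ))) := fun j =>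
      fderiv_fderiv_apply_comm ((hUi j).of_le (by norm_cast)) x _ _
    simp only [hcomm]
    have hds : ∀ j ∈ (Finset.univ : Finset (Fin 3)),
        DifferentiableAt ℝ (fun y => fderiv ℝ (fun z => U z j) y ((EuclideanSpace.single (j : Fin 3) (1 : ℝ)))) x := fun j _ =>
      (hd j j).differentiable (by norm_cast) x
    have h := congrArg (fun f : (EuclideanSpace ℝ (Fin 3)) → ℝ => fderiv ℝ f x ((EuclideanSpace.single (i : Fin 3) (1 : ℝ)))) hdiv0
    simp only at h
    rw [fderiv_fun_sum hds] at h
    simpa using h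
  rw [hsum0, mul_zero, sub_zero, add_sub_cancel_right]

/-- **`ΔP = Σᵢⱼ ∂ᵢ∂ⱼT_{ij}`** (differentiate `∂ᵢP = Σⱼ∂ⱼT_{ij}` once more and sum). [folklore] -/
theorem laplacian_pressure_eq_sum (hprof : IsLerayProfile ν 0 U P) (hU : ContDiff ℝ ∞ U) (x : (EuclideanSpace ℝ (Fin 3))) :
    (Δ P) x = ∑ i : Fin 3, ∑ j : Fin 3, fderiv ℝ (fun y => fderiv ℝ (fun y' =>
      ν * (fderiv ℝ (fun z => U z i) y' ((EuclideanSpace.single (j : Fin 3) (1 : ℝ))) - fderiv ℝ (fun z => U z j) y' ((EuclideanSpace.single (i : Fin 3) (1 : ℝ)))) - U y' i * U y' j)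
        y ((EuclideanSpace.single (j : Fin 3) (1 : ℝ)))) x ((EuclideanSpace.single (i : Fin 3) (1 : ℝ))) := by
  have hP : ContDiff ℝ ∞ P := contDiff_pressure_top hprof hU
  have hUi : ∀ k : Fin 3, ContDiff ℝ ∞ fun y => U y k := fun k => contDiff_euclidean.1 hU k
  have hT : ∀ i j : Fin 3, ContDiff ℝ ∞ fun y' =>
      ν * (fderiv ℝ (fun z => U z i) y' ((EuclideanSpace.single (j : Fin 3) (1 : ℝ))) - fderiv ℝ (fun z => U z j) y' ((EuclideanSpace.single (i : Fin 3) (1 : ℝ)))) - U y' i * U y' j :=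
    fun i j => (contDiff_const.mul ((contDiff_pd (hUi i) _).sub (contDiff_pd (hUi j) _))).sub
      ((hUi i).mul (hUi j))
  rw [laplacian_eq_sum_three (hP.of_le (by norm_cast))]
  refine Finset.sum_congr rfl fun i _ => ?_
  have hfun : (fun y => fderiv ℝ P y ((EuclideanSpace.single (i : Fin 3) (1 : ℝ)))) = fun y => ∑ j : Fin 3, fderiv ℝ (fun y' =>
      ν * (fderiv ℝ (fun z => U z i) y' ((EuclideanSpace.single (j : Fin 3) (1 : ℝ))) - fderiv ℝ (fun z => U z j) y' ((EuclideanSpace.single (i : Fin 3) (1 : ℝ)))) - U y' i * U y' j)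
        y ((EuclideanSpace.single (j : Fin 3) (1 : ℝ))) := funext fun y => pressure_pd_eq_sum hprof hU y i
  rw [hfun]
  have hds : ∀ j ∈ (Finset.univ : Finset (Fin 3)), DifferentiableAt ℝ (fun y => fderiv ℝ (fun y' =>
      ν * (fderiv ℝ (fun z => U z i) y' ((EuclideanSpace.single (j : Fin 3) (1 : ℝ))) - fderiv ℝ (fun z => U z j) y' ((EuclideanSpace.single (i : Fin 3) (1 : ℝ)))) - U y' i * U y' j)
        y ((EuclideanSpace.single (j : Fin 3) (1 : ℝ)))) x := fun j _ => (contDiff_pd (hT i j) _).differentiable (by norm_cast) x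
  rw [fderiv_fun_sum hds]
  simp only [FunLike.coe_sum, Finset.sum_apply]

end Stress

/-! ### §3. Step 3: the local pressure `p₁` and the gradient of `P − p₁` -/

section Pressure

variable {ν : ℝ} {r₀ r₁ : ℝ} {p : ℝ≥0∞}

/-- Kernel constants from `λ`: one finite `Kq` dominating the conjugate-exponent norms of the
first and third directional derivatives of `λ` along basis vectors. [folklore] -/
theorem exists_kernel_bound (h₀ : 0 < r₀) (h₁ : r₀ < r₁) (q : ℝ≥0∞) :
    ∃ Kq : ℝ≥0∞, Kq < ⊤ ∧
      (∀ k : Fin 3, eLpNorm (fun z => fderiv ℝ (newtonFarLaplacian r₀ r₁) z ((EuclideanSpace.single (k : Fin 3) (1 : ℝ)))) q volume ≤ Kq) ∧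
      (∀ a b c : Fin 3, eLpNorm (fun z => fderiv ℝ (fun z₁ => fderiv ℝ (fun z₂ =>
        fderiv ℝ (newtonFarLaplacian r₀ r₁) z₂ ((EuclideanSpace.single (a : Fin 3) (1 : ℝ)))) z₁ ((EuclideanSpace.single (b : Fin 3) (1 : ℝ)))) z ((EuclideanSpace.single (c : Fin 3) (1 : ℝ)))) q volume ≤ Kq) := by
  set lam := newtonFarLaplacian r₀ r₁ with hlam
  have hl : ContDiff ℝ ∞ lam := contDiff_newtonFarLaplacian h₀ h₁
  have hlc : HasCompactSupport lam := hasCompactSupport_newtonFarLaplacian h₀.le h₁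
  set κ₁ : Fin 3 → (EuclideanSpace ℝ (Fin 3)) → ℝ := fun k z => fderiv ℝ lam z ((EuclideanSpace.single (k : Fin 3) (1 : ℝ))) with hκ₁
  set κ₃ : Fin 3 → Fin 3 → Fin 3 → (EuclideanSpace ℝ (Fin 3)) → ℝ := fun a b c z =>
    fderiv ℝ (fun z₁ => fderiv ℝ (fun z₂ => fderiv ℝ lam z₂ ((EuclideanSpace.single (a : Fin 3) (1 : ℝ)))) z₁ ((EuclideanSpace.single (b : Fin 3) (1 : ℝ)))) z ((EuclideanSpace.single (c : Fin 3) (1 : ℝ))) with hκ₃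
  have h1 : ∀ k, eLpNorm (κ₁ k) q volume < ⊤ := fun k =>
    eLpNorm_lt_top_of_hasCompactSupport (contDiff_pd hl _).continuous (hasCompactSupport_pd hlc _) q
  have h3 : ∀ a b c, eLpNorm (κ₃ a b c) q volume < ⊤ := fun a b c =>
    eLpNorm_lt_top_of_hasCompactSupport (contDiff_pd (contDiff_pd (contDiff_pd hl _) _) _).continuous
      (hasCompactSupport_pd (hasCompactSupport_pd (hasCompactSupport_pd hlc _) _) _) q
  refine ⟨(∑ k : Fin 3, eLpNorm (κ₁ k) q volume) +
    ∑ a : Fin 3, ∑ b : Fin 3, ∑ c : Fin 3, eLpNorm (κ₃ a b c) q volume, ?_, fun k => ?_, fun a b c => ?_⟩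
  · refine ENNReal.add_lt_top.2 ⟨ENNReal.sum_lt_top.2 fun k _ => h1 k, ENNReal.sum_lt_top.2 fun a _ =>
      ENNReal.sum_lt_top.2 fun b _ => ENNReal.sum_lt_top.2 fun c _ => h3 a b c⟩
  · exact (Finset.single_le_sum (f := fun k => eLpNorm (κ₁ k) q volume) (fun _ _ => zero_le)
      (Finset.mem_univ k)).trans le_self_add
  · refine le_trans ?_ le_add_self
    refine le_trans ?_ (Finset.single_le_sum (f := fun a => ∑ b : Fin 3, ∑ c : Fin 3,
      eLpNorm (κ₃ a b c) q volume) (fun _ _ => zero_le) (Finset.mem_univ a))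
    refine le_trans ?_ (Finset.single_le_sum (f := fun b => ∑ c : Fin 3,
      eLpNorm (κ₃ a b c) q volume) (fun _ _ => zero_le) (Finset.mem_univ b))
    exact Finset.single_le_sum (f := fun c => eLpNorm (κ₃ a b c) q volume) (fun _ _ => zero_le)
      (Finset.mem_univ c)

/-- **Step 3 (the pressure gradient is controlled locally by the velocity alone).** Fix `ν > 0`,
radii `0 < r₀ < r₁`, `1 < p < ∞`, a cut-off `χ₁ ∈ C_c^∞` supported in the measurable set `K`, a
second cut-off `χ ∈ C_c^∞` with `|χ| ≤ 1` on whose support `χ₁ = 1`, an open set `O` on which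
`χ = 1`, and a set `A` whose `2r₁`-neighbourhood lies in `O`. Then there is `C` such that for
every smooth steady profile `(U, P)` there is a smooth `p₁` (the *local pressure*
`p₁ = Σᵢⱼ ∂ᵢ∂ⱼN[χT_{ij}]`, `T_{ij} = ν(∂ⱼUᵢ − ∂ᵢUⱼ) − UᵢUⱼ`) with
`‖p₁‖_{L^p((EuclideanSpace ℝ (Fin 3)))} ≤ C B` and `sup_A |∇(P − p₁)| ≤ C B`, `B = ‖U‖_{L^p(K)} + ‖U‖²_{L^{2p}(K)}`.
This is the pressure half of the pressure-independent interior estimate (Tsai 2021, Lemma 3.1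
and Lemma 3.2, there via Bogovskiĭ's map), proved here by Green's representation at scale `r₁`
applied to `∂ₖ(P − p₁)`: on `O`, `Δ(P − p₁) = Λ[τ]`, `τ = Σᵢⱼ∂ᵢ∂ⱼ(χT_{ij})`, and
`Λ[∂ₖ(P − p₁)] = Σⱼ (∂ⱼλ) ⋆ (χT_{kj}) − (∂ₖλ) ⋆ p₁` near `A`. [cite: Tsai2021, Lemma 3.2 (pressure estimate on annuli)] -/
theorem pressure_gradient_bound (hν : 0 < ν) (h₀ : 0 < r₀) (h₁ : r₀ < r₁) (hp : 1 < p)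
    (hp' : p < ⊤) {χ₁ χ : (EuclideanSpace ℝ (Fin 3)) → ℝ} (hχ₁ : ContDiff ℝ ∞ χ₁) (hχ₁c : HasCompactSupport χ₁)
    (hχ : ContDiff ℝ ∞ χ) (hχc : HasCompactSupport χ) {K : Set (EuclideanSpace ℝ (Fin 3))} (hK : MeasurableSet K)
    (hχ₁K : tsupport χ₁ ⊆ K) (hχχ₁ : ∀ x, χ x ≠ 0 → χ₁ x = 1) (hχle : ∀ x, |χ x| ≤ 1)
    {O : Set (EuclideanSpace ℝ (Fin 3))} (hO : IsOpen O) (hχO : ∀ x ∈ O, χ x = 1) {A : Set (EuclideanSpace ℝ (Fin 3))}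
    (hAO : ∀ x ∈ A, closedBall x (r₁ + r₁) ⊆ O) :
    ∃ C : ℝ≥0, ∀ (U : (EuclideanSpace ℝ (Fin 3)) → (EuclideanSpace ℝ (Fin 3))) (P : (EuclideanSpace ℝ (Fin 3)) → ℝ), IsLerayProfile ν 0 U P → ContDiff ℝ ∞ U →
      ∃ p₁ : (EuclideanSpace ℝ (Fin 3)) → ℝ, ContDiff ℝ ∞ p₁ ∧
        eLpNorm p₁ p volume ≤
          C * (eLpNorm U p (volume.restrict K) + eLpNorm U (2 * p) (volume.restrict K) ^ (2 : ℝ)) ∧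
        ∀ x ∈ A, ‖fderiv ℝ (fun y => P y - p₁ y) x‖ₑ ≤
          C * (eLpNorm U p (volume.restrict K) + eLpNorm U (2 * p) (volume.restrict K) ^ (2 : ℝ)) := by
  have hp1 : 1 ≤ p := hp.le
  obtain ⟨C, hN0, hN1, hN2, hΛ0, hΛ1⟩ := exists_operator_bounds h₀ h₁ hp hp'
  obtain ⟨C₁, hC₁⟩ := vorticity_cutoff_bound hν h₀ h₁ hp hp' hχ₁ hχ₁c hK hχ₁K
  obtain ⟨Kq, hKq, hκ₁, hκ₃⟩ := exists_kernel_bound h₀ h₁ (1 - p⁻¹)⁻¹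
  have hI₀ : (∫⁻ z, ‖newtonNear r₀ r₁ z‖ₑ) < ⊤ := lintegral_enorm_newtonNear_lt_top h₀.le h₁
  set I₀ : ℝ≥0∞ := ∫⁻ z, ‖newtonNear r₀ r₁ z‖ₑ with hI₀def
  -- the final constant
  set E : ℝ≥0∞ := (9 * C + 3 * ((9 * I₀ + 3 + 9 * C) * Kq)) * (ENNReal.ofReal ν * C₁ + 1) with hE
  have hEtop : E ≠ ⊤ := by
    rw [hE]
    refine ENNReal.mul_ne_top ?_ ?_
    · refine ENNReal.add_ne_top.2 ⟨ENNReal.mul_ne_top (by norm_num) ENNReal.coe_ne_top,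
        ENNReal.mul_ne_top (by norm_num) (ENNReal.mul_ne_top ?_ hKq.ne)⟩
      exact ENNReal.add_ne_top.2 ⟨ENNReal.add_ne_top.2 ⟨ENNReal.mul_ne_top (by norm_num) hI₀.ne,
        by norm_num⟩, ENNReal.mul_ne_top (by norm_num) ENNReal.coe_ne_top⟩
    · exact ENNReal.add_ne_top.2 ⟨ENNReal.mul_ne_top ENNReal.ofReal_ne_top ENNReal.coe_ne_top,
        ENNReal.one_ne_top⟩
  refine ⟨E.toNNReal, fun U P hprof hU => ?_⟩
  rw [ENNReal.coe_toNNReal hEtop]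
  -- smoothness
  have he : ∀ l : Fin 3, ‖(EuclideanSpace.single (l : Fin 3) (1 : ℝ))‖ ≤ 1 := fun l => (norm_single_one l).le
  have hP : ContDiff ℝ ∞ P := contDiff_pressure_top hprof hU
  have hUi : ∀ k : Fin 3, ContDiff ℝ ∞ fun y => U y k := fun k => contDiff_euclidean.1 hU k
  have hF : ∀ k l : Fin 3, ContDiff ℝ ∞ fun y => U y k * U y l := fun k l => (hUi k).mul (hUi l)
  have hsuppχ : support χ ⊆ support χ₁ := fun x hx => by
    rw [mem_support] at hx ⊢
    rw [hχχ₁ x hx]; exact one_ne_zero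
  have hχK : tsupport χ ⊆ K := (closure_mono hsuppχ).trans hχ₁K
  -- the stress and its localisation
  set T : Fin 3 → Fin 3 → (EuclideanSpace ℝ (Fin 3)) → ℝ := fun i j y =>
    ν * (fderiv ℝ (fun z => U z i) y ((EuclideanSpace.single (j : Fin 3) (1 : ℝ))) - fderiv ℝ (fun z => U z j) y ((EuclideanSpace.single (i : Fin 3) (1 : ℝ)))) - U y i * U y j with hT
  set Tt : Fin 3 → Fin 3 → (EuclideanSpace ℝ (Fin 3)) → ℝ := fun i j y => χ y * T i j y with hTt
  have hTs : ∀ i j, ContDiff ℝ ∞ (T i j) := fun i j =>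
    (contDiff_const.mul ((contDiff_pd (hUi i) _).sub (contDiff_pd (hUi j) _))).sub (hF i j)
  have hTts : ∀ i j, ContDiff ℝ ∞ (Tt i j) := fun i j => hχ.mul (hTs i j)
  have hTtc : ∀ i j, HasCompactSupport (Tt i j) := fun i j => hχc.mul_right
  -- `B` and the bound `‖χT_{ij}‖_p ≤ B'`
  set B : ℝ≥0∞ := eLpNorm U p (volume.restrict K) + eLpNorm U (2 * p) (volume.restrict K) ^ (2 : ℝ)
    with hB
  set B' : ℝ≥0∞ := (ENNReal.ofReal ν * C₁ + 1) * B with hB'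
  have hTtB : ∀ i j, eLpNorm (Tt i j) p volume ≤ B' := by
    intro i j
    have hsplit : Tt i j = fun y => ν * (χ y * (fderiv ℝ (fun z => U z i) y ((EuclideanSpace.single (j : Fin 3) (1 : ℝ)))
        - fderiv ℝ (fun z => U z j) y ((EuclideanSpace.single (i : Fin 3) (1 : ℝ))))) - χ y * (U y i * U y j) := by
      funext y; simp only [hTt, hT]; ring
    rw [hsplit]
    have hm1 : AEStronglyMeasurable (fun y => ν * (χ y * (fderiv ℝ (fun z => U z i) y ((EuclideanSpace.single (j : Fin 3) (1 : ℝ)))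
        - fderiv ℝ (fun z => U z j) y ((EuclideanSpace.single (i : Fin 3) (1 : ℝ)))))) volume :=
      (continuous_const.mul (hχ.continuous.mul ((contDiff_pd (hUi i) _).sub
        (contDiff_pd (hUi j) _)).continuous)).aestronglyMeasurable
    have hm2 : AEStronglyMeasurable (fun y => χ y * (U y i * U y j)) volume :=
      (hχ.continuous.mul (hF i j).continuous).aestronglyMeasurable
    refine (eLpNorm_sub_le hm1 hm2 hp1).trans ?_
    rw [hB', add_mul, one_mul]
    refine add_le_add ?_ ?_
    · have e1 : (fun y => ν * (χ y * (fderiv ℝ (fun z => U z i) y ((EuclideanSpace.single (j : Fin 3) (1 : ℝ)))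
          - fderiv ℝ (fun z => U z j) y ((EuclideanSpace.single (i : Fin 3) (1 : ℝ)))))) =
          ν • fun y => χ y * (fderiv ℝ (fun z => U z i) y ((EuclideanSpace.single (j : Fin 3) (1 : ℝ))) - fderiv ℝ (fun z => U z j) y ((EuclideanSpace.single (i : Fin 3) (1 : ℝ)))) :=
        rfl
      rw [e1, eLpNorm_const_smul, Real.enorm_eq_ofReal hν.le, mul_assoc]
      gcongr
      -- `|χ ω| ≤ |χ₁ ω|` pointwise, then Step 1
      refine le_trans (eLpNorm_mono_real (g := fun y => ‖χ₁ y * (fderiv ℝ (fun z => U z i) y ((EuclideanSpace.single (j : Fin 3) (1 : ℝ)))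
        - fderiv ℝ (fun z => U z j) y ((EuclideanSpace.single (i : Fin 3) (1 : ℝ))))‖) fun y => ?_) ?_
      · by_cases hy : χ y = 0
        · simp only [hy, zero_mul, norm_zero]; positivity
        · rw [norm_mul, norm_mul, hχχ₁ y hy, norm_one, one_mul, Real.norm_eq_abs]
          exact mul_le_of_le_one_left (norm_nonneg _) (hχle y)
      · rw [eLpNorm_norm]
        exact hC₁ U P hprof hU j i
    · refine (eLpNorm_mul_le_of_abs_le_of_support hK hχle
        (fun x hx => image_eq_zero_of_notMem_tsupport fun h => hx (hχK h)) _ p).trans ?_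
      rw [ENNReal.ofReal_one, one_mul]
      exact (eLpNorm_apply_mul_apply_le U i j p _).trans le_add_self
  -- `τ` and the local pressure `p₁ = N[τ]`
  set τ : (EuclideanSpace ℝ (Fin 3)) → ℝ := fun x => ∑ i : Fin 3, ∑ j : Fin 3,
    fderiv ℝ (fun y => fderiv ℝ (Tt i j) y ((EuclideanSpace.single (j : Fin 3) (1 : ℝ)))) x ((EuclideanSpace.single (i : Fin 3) (1 : ℝ))) with hτ
  have hτij : ∀ i j, ContDiff ℝ ∞ fun x => fderiv ℝ (fun y => fderiv ℝ (Tt i j) y ((EuclideanSpace.single (j : Fin 3) (1 : ℝ)))) x ((EuclideanSpace.single (i : Fin 3) (1 : ℝ))) :=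
    fun i j => contDiff_pd (contDiff_pd (hTts i j) _) _
  have hτs : ContDiff ℝ ∞ τ := ContDiff.sum fun i _ => ContDiff.sum fun j _ => hτij i j
  set p₁ : (EuclideanSpace ℝ (Fin 3)) → ℝ := newtonNearPotential r₀ r₁ τ with hp₁
  have hp₁s : ContDiff ℝ ∞ p₁ := contDiff_newtonNearPotential_top h₀.le h₁ hτs
  have hp₁B : eLpNorm p₁ p volume ≤ 9 * C * B' := by
    rw [hp₁, hτ]
    refine (eLpNorm_newtonNearPotential_sum_le h₀.le h₁ hp1 _ fun i =>
      (ContDiff.sum fun j _ => hτij i j).continuous).trans ?_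
    refine (Finset.sum_le_sum fun i _ => eLpNorm_newtonNearPotential_sum_le h₀.le h₁ hp1 _
      fun j => (hτij i j).continuous).trans ?_
    refine (Finset.sum_le_sum fun i _ => Finset.sum_le_sum fun j _ =>
      (hN2 (Tt i j) ((hTts i j).of_le (by norm_cast)) (hTtc i j) _ _ (he j) (he i)).trans
        (mul_le_mul' le_rfl (hTtB i j))).trans ?_
    simp only [Finset.sum_const, Finset.card_univ, Fintype.card_fin, nsmul_eq_mul, Nat.cast_ofNat]
    apply le_of_eq; ring
  refine ⟨p₁, hp₁s, hp₁B.trans ?_, fun x hx => ?_⟩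
  · rw [hB', hE]
    calc 9 * ↑C * ((ENNReal.ofReal ν * ↑C₁ + 1) * B)
        = (9 * ↑C) * (ENNReal.ofReal ν * ↑C₁ + 1) * B := by ring
      _ ≤ (9 * ↑C + 3 * ((9 * I₀ + 3 + 9 * ↑C) * Kq)) * (ENNReal.ofReal ν * ↑C₁ + 1) * B := by
          gcongr; exact le_self_add
  ----------------------------------------------------------------
  -- the gradient of `h = P − p₁` on `A`
  ----------------------------------------------------------------
  set lam := newtonFarLaplacian r₀ r₁ with hlam
  have hls : ContDiff ℝ ∞ lam := contDiff_newtonFarLaplacian h₀ h₁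
  have hlc : HasCompactSupport lam := hasCompactSupport_newtonFarLaplacian h₀.le h₁
  have hltsupp : tsupport lam ⊆ closedBall (0 : (EuclideanSpace ℝ (Fin 3))) r₁ := tsupport_newtonFarLaplacian_subset h₀.le h₁
  have hr₁ : 0 < r₁ := h₀.trans h₁
  set h : (EuclideanSpace ℝ (Fin 3)) → ℝ := fun y => P y - p₁ y with hh
  have hhs : ContDiff ℝ ∞ h := hP.sub hp₁s
  -- (g1) `∂ₖh = Σⱼ ∂ⱼT_{kj} − ∂ₖp₁`
  have g1 : ∀ (y : (EuclideanSpace ℝ (Fin 3))) (k : Fin 3), fderiv ℝ h y ((EuclideanSpace.single (k : Fin 3) (1 : ℝ))) =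
      ∑ j : Fin 3, fderiv ℝ (T k j) y ((EuclideanSpace.single (j : Fin 3) (1 : ℝ))) - fderiv ℝ p₁ y ((EuclideanSpace.single (k : Fin 3) (1 : ℝ))) := by
    intro y k
    rw [hh, fderiv_fun_sub (hP.differentiable (by norm_cast) y) (hp₁s.differentiable (by norm_cast) y)]
    simp only [FunLike.coe_sub, Pi.sub_apply]
    rw [pressure_pd_eq_sum hprof hU y k]
  -- (g3) `Δh = Λ[τ]` on `O`
  have g3 : ∀ y ∈ O, (Δ h) y = newtonFarSmoothing r₀ r₁ τ y := by
    intro y hy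
    have hΔh : (Δ h) y = (Δ P) y - (Δ p₁) y :=
      ContDiffAt.laplacian_sub (hP.of_le (by norm_cast) : ContDiff ℝ 2 P).contDiffAt
        (hp₁s.of_le (by norm_cast) : ContDiff ℝ 2 p₁).contDiffAt
    have hΔp₁ : (Δ p₁) y = τ y - newtonFarSmoothing r₀ r₁ τ y :=
      laplacian_newtonNearPotential h₀ h₁ (hτs.of_le (by norm_cast)) y
    have hΔP : (Δ P) y = τ y := by
      rw [laplacian_pressure_eq_sum hprof hU y, hτ]
      refine Finset.sum_congr rfl fun i _ => Finset.sum_congr rfl fun j _ => ?_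
      have hev : Tt i j =ᶠ[𝓝 y] T i j := by
        filter_upwards [hO.mem_nhds hy] with y' hy'
        simp only [hTt, hχO y' hy', one_mul]
      have hev2 : (fun y' => fderiv ℝ (Tt i j) y' ((EuclideanSpace.single (j : Fin 3) (1 : ℝ)))) =ᶠ[𝓝 y] fun y' => fderiv ℝ (T i j) y' ((EuclideanSpace.single (j : Fin 3) (1 : ℝ))) :=
        hev.fderiv.mono fun y' hy' => by
          show fderiv ℝ (Tt i j) y' ((EuclideanSpace.single (j : Fin 3) (1 : ℝ))) = fderiv ℝ (T i j) y' ((EuclideanSpace.single (j : Fin 3) (1 : ℝ)))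
          rw [hy']
      rw [hev2.fderiv_eq]
    rw [hΔh, hΔp₁, hΔP]; ring
  -- (g4) on `O`: `Δ(∂ₖh) = ∂ₖ(Λ[τ])`
  have g4 : ∀ y ∈ O, ∀ k : Fin 3, (Δ (fun y' => fderiv ℝ h y' ((EuclideanSpace.single (k : Fin 3) (1 : ℝ))))) y =
      fderiv ℝ (newtonFarSmoothing r₀ r₁ τ) y ((EuclideanSpace.single (k : Fin 3) (1 : ℝ))) := by
    intro y hy k
    rw [← fderiv_laplacian_apply (hhs.of_le (by norm_cast)) y ((EuclideanSpace.single (k : Fin 3) (1 : ℝ)))]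
    have hev : (Δ h) =ᶠ[𝓝 y] newtonFarSmoothing r₀ r₁ τ := by
      filter_upwards [hO.mem_nhds hy] with y' hy' using g3 y' hy'
    rw [hev.fderiv_eq]
  -- (g5) the bound for `∂ₖΛ[τ] = Σᵢⱼ (∂ⱼ∂ᵢ∂ₖλ) ⋆ (χT_{ij})`
  have g5 : ∀ (y : (EuclideanSpace ℝ (Fin 3))) (k : Fin 3), ‖fderiv ℝ (newtonFarSmoothing r₀ r₁ τ) y ((EuclideanSpace.single (k : Fin 3) (1 : ℝ)))‖ₑ ≤ 9 * (Kq * B') := by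
    intro y k
    rw [fderiv_newtonFarSmoothing_apply h₀ h₁ (hτs.of_le (by norm_cast)) y ((EuclideanSpace.single (k : Fin 3) (1 : ℝ))),
      newtonFarSmoothing_apply]
    -- `∂ₖτ = Σᵢⱼ ∂ₖ∂ᵢ∂ⱼ(χT)`
    set G : Fin 3 → Fin 3 → (EuclideanSpace ℝ (Fin 3)) → ℝ := fun i j w =>
      fderiv ℝ (fun y₁ => fderiv ℝ (fun y₂ => fderiv ℝ (Tt i j) y₂ ((EuclideanSpace.single (j : Fin 3) (1 : ℝ)))) y₁ ((EuclideanSpace.single (i : Fin 3) (1 : ℝ)))) w ((EuclideanSpace.single (k : Fin 3) (1 : ℝ))) with hG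
    have hGc : ∀ i j, Continuous (G i j) := fun i j => (contDiff_pd (hτij i j) _).continuous
    have hτk : ∀ w, fderiv ℝ τ w ((EuclideanSpace.single (k : Fin 3) (1 : ℝ))) = ∑ i : Fin 3, ∑ j : Fin 3, G i j w := by
      intro w
      have hd1 : ∀ i ∈ (Finset.univ : Finset (Fin 3)), DifferentiableAt ℝ
          (fun x => ∑ j : Fin 3, fderiv ℝ (fun y => fderiv ℝ (Tt i j) y ((EuclideanSpace.single (j : Fin 3) (1 : ℝ)))) x ((EuclideanSpace.single (i : Fin 3) (1 : ℝ)))) w :=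
        fun i _ => (ContDiff.sum fun j _ => hτij i j).differentiable (by norm_cast) w
      have hd2 : ∀ i, ∀ j ∈ (Finset.univ : Finset (Fin 3)), DifferentiableAt ℝ
          (fun x => fderiv ℝ (fun y => fderiv ℝ (Tt i j) y ((EuclideanSpace.single (j : Fin 3) (1 : ℝ)))) x ((EuclideanSpace.single (i : Fin 3) (1 : ℝ)))) w :=
        fun i j _ => (hτij i j).differentiable (by norm_cast) w
      rw [hτ, fderiv_fun_sum hd1]
      simp only [FunLike.coe_sum, Finset.sum_apply]
      refine Finset.sum_congr rfl fun i _ => ?_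
      rw [fderiv_fun_sum (hd2 i)]
      simp only [FunLike.coe_sum, Finset.sum_apply, hG]
    simp only [hτk, Finset.mul_sum]
    have hint : ∀ i j, Integrable fun z => lam z * G i j (y - z) := fun i j =>
      integrable_newtonFarLaplacian_mul_comp_sub h₀ h₁ (hGc i j) y
    rw [integral_finsetSum _ fun i _ => integrable_finsetSum _ fun j _ => hint i j]
    refine (enorm_sum_le _ _).trans ?_
    refine (Finset.sum_le_sum fun i _ => ?_).trans ?_ (b := ∑ _i : Fin 3, ∑ _j : Fin 3, Kq * B')
    · rw [integral_finsetSum _ fun j _ => hint i j]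
      refine (enorm_sum_le _ _).trans (Finset.sum_le_sum fun j _ => ?_)
      rw [hG, integral_mul_pd_pd_pd_comp_sub hls hlc (hTts i j) y ((EuclideanSpace.single (k : Fin 3) (1 : ℝ))) ((EuclideanSpace.single (i : Fin 3) (1 : ℝ))) ((EuclideanSpace.single (j : Fin 3) (1 : ℝ)))]
      exact (enorm_integral_mul_comp_sub_le' hp1 (contDiff_pd (contDiff_pd (contDiff_pd hls _) _) _).continuous
        (hTts i j).continuous (hκ₃ k i j) y).trans (mul_le_mul' le_rfl (hTtB i j))
    · simp only [Finset.sum_const, Finset.card_univ, Fintype.card_fin, nsmul_eq_mul, Nat.cast_ofNat]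
      apply le_of_eq; ring
  -- (g6) the two terms of `∂ₖh(x) = N[Δ∂ₖh](x) + Λ[∂ₖh](x)` for `x ∈ A`
  have hxO : closedBall x (r₁ + r₁) ⊆ O := hAO x hx
  have g6 : ∀ k : Fin 3, ‖fderiv ℝ h x ((EuclideanSpace.single (k : Fin 3) (1 : ℝ)))‖ₑ ≤ (9 * I₀ + 3 + 9 * C) * (Kq * B') := by
    intro k
    have hks : ContDiff ℝ ∞ fun y' => fderiv ℝ h y' ((EuclideanSpace.single (k : Fin 3) (1 : ℝ))) := contDiff_pd hhs _
    rw [eq_newtonNearPotential_laplacian_add h₀ h₁ (hks.of_le (by norm_cast)) x]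
    refine (enorm_add_le _ _).trans ?_
    have hA1 : ‖newtonNearPotential r₀ r₁ (Δ fun y' => fderiv ℝ h y' ((EuclideanSpace.single (k : Fin 3) (1 : ℝ)))) x‖ₑ ≤ I₀ * (9 * (Kq * B')) := by
      rw [newtonNearPotential_congr_of_eqOn h₀.le h₁ (ε := r₁)
        (g := fun y => fderiv ℝ (newtonFarSmoothing r₀ r₁ τ) y ((EuclideanSpace.single (k : Fin 3) (1 : ℝ))))
        (fun y hy => g4 y (hxO hy) k) (mem_ball_self hr₁)]
      exact enorm_newtonNearPotential_le_of_bound r₀ r₁ (fun y => g5 y k) x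
    have hA2 : ‖newtonFarSmoothing r₀ r₁ (fun y' => fderiv ℝ h y' ((EuclideanSpace.single (k : Fin 3) (1 : ℝ)))) x‖ₑ ≤
        3 * (Kq * B') + Kq * (9 * C * B') := by
      rw [newtonFarSmoothing_apply]
      simp only [g1]
      have hi1 : ∀ j, Integrable fun z => lam z * fderiv ℝ (T k j) (x - z) ((EuclideanSpace.single (j : Fin 3) (1 : ℝ))) := fun j =>
        integrable_newtonFarLaplacian_mul_comp_sub h₀ h₁ (contDiff_pd (hTs k j) _).continuous x
      have hi2 : Integrable fun z => lam z * fderiv ℝ p₁ (x - z) ((EuclideanSpace.single (k : Fin 3) (1 : ℝ))) :=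
        integrable_newtonFarLaplacian_mul_comp_sub h₀ h₁ (contDiff_pd hp₁s _).continuous x
      have hi1s : Integrable fun z => lam z * ∑ j : Fin 3, fderiv ℝ (T k j) (x - z) ((EuclideanSpace.single (j : Fin 3) (1 : ℝ))) := by
        have := integrable_finsetSum (Finset.univ : Finset (Fin 3)) fun j _ => hi1 j
        refine this.congr (Eventually.of_forall fun z => ?_)
        simp only [Finset.mul_sum]
      simp only [mul_sub]
      rw [integral_sub hi1s hi2]
      refine (enorm_sub_le).trans (add_le_add ?_ ?_)
      · simp only [Finset.mul_sum]
        rw [integral_finsetSum _ fun j _ => hi1 j]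
        refine (enorm_sum_le _ _).trans ?_
        refine (Finset.sum_le_sum fun j _ => ?_).trans ?_ (b := ∑ _j : Fin 3, Kq * B')
        · rw [integral_mul_pd_comp_sub lam (hls.of_le (by norm_cast)) hlc ((hTs k j).of_le (by norm_cast))
            x ((EuclideanSpace.single (j : Fin 3) (1 : ℝ)))]
          -- replace `T` by `χT` inside the ball
          have heq : ∫ z, fderiv ℝ lam z ((EuclideanSpace.single (j : Fin 3) (1 : ℝ))) * T k j (x - z) =
              ∫ z, fderiv ℝ lam z ((EuclideanSpace.single (j : Fin 3) (1 : ℝ))) * Tt k j (x - z) := by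
            refine integral_congr_ae (Eventually.of_forall fun z => ?_)
            by_cases hz : ‖z‖ ≤ r₁
            · have hxz : x - z ∈ O := hxO (by
                rw [mem_closedBall, dist_eq_norm, sub_sub_cancel_left, norm_neg]; linarith)
              simp only [hTt, hχO _ hxz, one_mul]
            · have hz' : z ∉ tsupport lam := fun h' => hz (mem_closedBall_zero_iff.1 (hltsupp h'))
              simp only [pd_eq_zero_of_notMem_tsupport hz', zero_mul]
          rw [heq]
          exact (enorm_integral_mul_comp_sub_le' hp1 (contDiff_pd hls _).continuous
            (hTts k j).continuous (hκ₁ j) x).trans (mul_le_mul' le_rfl (hTtB k j))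
        · simp only [Finset.sum_const, Finset.card_univ, Fintype.card_fin, nsmul_eq_mul, Nat.cast_ofNat]
          exact le_rfl
      · rw [integral_mul_pd_comp_sub lam (hls.of_le (by norm_cast)) hlc (hp₁s.of_le (by norm_cast)) x ((EuclideanSpace.single (k : Fin 3) (1 : ℝ)))]
        exact (enorm_integral_mul_comp_sub_le' hp1 (contDiff_pd hls _).continuous hp₁s.continuous
          (hκ₁ k) x).trans (mul_le_mul' le_rfl hp₁B)
    refine (add_le_add hA1 hA2).trans (le_of_eq ?_)
    ring
  -- (g7) sum over the three directions
  have hnorm : ‖fderiv ℝ h x‖ₑ ≤ ∑ k : Fin 3, ‖fderiv ℝ h x ((EuclideanSpace.single (k : Fin 3) (1 : ℝ)))‖ₑ := by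
    rw [← ofReal_norm]
    refine (ENNReal.ofReal_le_ofReal (opNorm_le_sum_abs (fderiv ℝ h x))).trans ?_
    rw [ENNReal.ofReal_sum_of_nonneg fun k _ => abs_nonneg _]
    refine Finset.sum_le_sum fun k _ => le_of_eq ?_
    rw [← Real.norm_eq_abs, ofReal_norm]
  refine hnorm.trans ((Finset.sum_le_sum fun k _ => g6 k).trans ?_)
  simp only [Finset.sum_const, Finset.card_univ, Fintype.card_fin, nsmul_eq_mul, Nat.cast_ofNat]
  rw [hB', hE]
  calc 3 * ((9 * I₀ + 3 + 9 * ↑C) * (Kq * ((ENNReal.ofReal ν * ↑C₁ + 1) * B)))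
      = (3 * ((9 * I₀ + 3 + 9 * ↑C) * Kq)) * (ENNReal.ofReal ν * ↑C₁ + 1) * B := by ring
    _ ≤ (9 * ↑C + 3 * ((9 * I₀ + 3 + 9 * ↑C) * Kq)) * (ENNReal.ofReal ν * ↑C₁ + 1) * B := by
        gcongr; exact le_add_self

end Pressure



/-! ### §4. Geometry: oscillation of a `C¹` function over a spherical shell -/

section Geometry

/-- In `(EuclideanSpace ℝ (Fin 3))` every nonzero vector has a unit vector orthogonal to it. [folklore] -/
theorem exists_unit_orthogonal {u : (EuclideanSpace ℝ (Fin 3))} (hu : u ≠ 0) : ∃ w : (EuclideanSpace ℝ (Fin 3)), ‖w‖ = 1 ∧ ⟪u, w⟫ = 0 := by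
  haveI : Fact (Module.finrank ℝ (EuclideanSpace ℝ (Fin 3)) = 2 + 1) := ⟨by simp⟩
  have hdim : Module.finrank ℝ (ℝ ∙ u)ᗮ = 2 := Submodule.finrank_orthogonal_span_singleton hu
  have hne : (ℝ ∙ u)ᗮ ≠ ⊥ := by
    intro h
    rw [h, finrank_bot] at hdim
    exact absurd hdim (by norm_num)
  obtain ⟨b, hb, hb0⟩ := Submodule.exists_mem_ne_zero_of_ne_bot hne
  refine ⟨‖b‖⁻¹ • b, ?_, ?_⟩
  · rw [norm_smul, norm_inv, norm_norm, inv_mul_cancel₀ (norm_ne_zero_iff.2 hb0)]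
  · rw [inner_smul_right, (Submodule.mem_orthogonal_singleton_iff_inner_right).1 hb, mul_zero]

/-- **Spherical decomposition**: for unit vectors `u, v` of `(EuclideanSpace ℝ (Fin 3))` there is a unit `w ⊥ u` with
`v = cos θ • u + sin θ • w`, `θ = arccos⟪u, v⟫`. [folklore] -/
theorem exists_cos_sin_decomp {u v : (EuclideanSpace ℝ (Fin 3))} (hu : ‖u‖ = 1) (hv : ‖v‖ = 1) :
    ∃ w : (EuclideanSpace ℝ (Fin 3)), ‖w‖ = 1 ∧ ⟪u, w⟫ = 0 ∧
      v = Real.cos (Real.arccos ⟪u, v⟫) • u + Real.sin (Real.arccos ⟪u, v⟫) • w := by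
  set c := ⟪u, v⟫ with hc
  have hc1 : |c| ≤ 1 := by simpa [hu, hv] using abs_real_inner_le_norm u v
  rw [Real.cos_arccos (abs_le.1 hc1).1 (abs_le.1 hc1).2, Real.sin_arccos]
  have hu0 : u ≠ 0 := by rw [← norm_ne_zero_iff, hu]; exact one_ne_zero
  set z := v - c • u with hz
  have huz : ⟪u, z⟫ = 0 := by
    rw [hz, inner_sub_right, inner_smul_right, real_inner_self_eq_norm_sq, hu]; ring
  have hz2 : ‖z‖ ^ 2 = 1 - c ^ 2 := by
    have h1 : ‖z‖ ^ 2 = ‖v‖ ^ 2 - 2 * ⟪v, c • u⟫ + ‖c • u‖ ^ 2 := by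
      rw [hz]; exact norm_sub_sq_real v (c • u)
    rw [h1, hv, inner_smul_right, real_inner_comm, ← hc, norm_smul, hu, Real.norm_eq_abs, mul_one,
      sq_abs]
    ring
  have hzn : ‖z‖ = Real.sqrt (1 - c ^ 2) := by rw [← hz2, Real.sqrt_sq (norm_nonneg _)]
  by_cases h0 : z = 0
  · obtain ⟨w, hw, huw⟩ := exists_unit_orthogonal hu0
    refine ⟨w, hw, huw, ?_⟩
    have hs : Real.sqrt (1 - c ^ 2) = 0 := by rw [← hzn, h0, norm_zero]
    rw [hs, zero_smul, add_zero]
    rw [hz, sub_eq_zero] at h0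
    exact h0
  · refine ⟨‖z‖⁻¹ • z, ?_, ?_, ?_⟩
    · rw [norm_smul, norm_inv, norm_norm, inv_mul_cancel₀ (norm_ne_zero_iff.2 h0)]
    · rw [inner_smul_right, huz, mul_zero]
    · rw [← hzn, smul_smul, mul_inv_cancel₀ (norm_ne_zero_iff.2 h0), one_smul, hz]
      abel

/-- `‖cos s • u + sin s • w‖ = 1` for orthonormal `u, w`. [folklore] -/
theorem norm_cos_smul_add_sin_smul {u w : (EuclideanSpace ℝ (Fin 3))} (hu : ‖u‖ = 1) (hw : ‖w‖ = 1) (huw : ⟪u, w⟫ = 0)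
    (s : ℝ) : ‖Real.cos s • u + Real.sin s • w‖ = 1 := by
  have h : ‖Real.cos s • u + Real.sin s • w‖ ^ 2 = 1 := by
    rw [norm_add_sq_real, norm_smul, norm_smul, hu, hw, inner_smul_left, inner_smul_right, huw,
      Real.norm_eq_abs, Real.norm_eq_abs, mul_one, mul_one, sq_abs, sq_abs]
    simp only [mul_zero, RCLike.conj_to_real, add_zero]
    rw [Real.cos_sq_add_sin_sq]
  have h0 : 0 ≤ ‖Real.cos s • u + Real.sin s • w‖ := norm_nonneg _
  nlinarith [h, h0]

/-- **Mean value bound along a great circle**: if `‖Df‖ ≤ G` on the sphere of radius `r > 0`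
(through a set `S` containing it) then `|f x − f y| ≤ 8 G r` for `‖x‖ = ‖y‖ = r` (join `x` to
`y` by the arc `t ↦ r(cos(θt) û + sin(θt) w)` of length `θr ≤ πr`). [folklore] -/
theorem abs_sub_le_of_sphere {f : (EuclideanSpace ℝ (Fin 3)) → ℝ} (hf : Differentiable ℝ f) {S : Set (EuclideanSpace ℝ (Fin 3))} {G r : ℝ}
    (hG : ∀ x ∈ S, ‖fderiv ℝ f x‖ ≤ G) (hr : 0 < r) (hS : ∀ x : (EuclideanSpace ℝ (Fin 3)), ‖x‖ = r → x ∈ S)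
    {x y : (EuclideanSpace ℝ (Fin 3))} (hx : ‖x‖ = r) (hy : ‖y‖ = r) : |f x - f y| ≤ G * (8 * r) := by
  obtain ⟨u, hu⟩ : ∃ u : (EuclideanSpace ℝ (Fin 3)), u = r⁻¹ • x := ⟨_, rfl⟩
  obtain ⟨v, hv⟩ : ∃ v : (EuclideanSpace ℝ (Fin 3)), v = r⁻¹ • y := ⟨_, rfl⟩
  have hun : ‖u‖ = 1 := by rw [hu, norm_smul, norm_inv, Real.norm_of_nonneg hr.le, hx, inv_mul_cancel₀ hr.ne']
  have hvn : ‖v‖ = 1 := by rw [hv, norm_smul, norm_inv, Real.norm_of_nonneg hr.le, hy, inv_mul_cancel₀ hr.ne']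
  obtain ⟨w, hw, huw, hdec⟩ := exists_cos_sin_decomp hun hvn
  set θ := Real.arccos ⟪u, v⟫ with hθ
  have hθ0 : 0 ≤ θ := Real.arccos_nonneg _
  have hθπ : θ ≤ Real.pi := Real.arccos_le_pi _
  have hG0 : 0 ≤ G := (norm_nonneg _).trans (hG x (hS x hx))
  -- the arc
  set γ : ℝ → (EuclideanSpace ℝ (Fin 3)) := fun t => r • (Real.cos (θ * t) • u + Real.sin (θ * t) • w) with hγ
  have hγn : ∀ t, ‖γ t‖ = r := fun t => by
    rw [hγ]; simp only
    rw [norm_smul, norm_cos_smul_add_sin_smul hun hw huw, mul_one, Real.norm_of_nonneg hr.le]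
  have hγ0 : γ 0 = x := by
    simp only [hγ, mul_zero, Real.cos_zero, Real.sin_zero, zero_smul, add_zero, hu, smul_smul]
    rw [one_mul, mul_inv_cancel₀ hr.ne', one_smul]
  have hγ1 : γ 1 = y := by
    simp only [hγ, mul_one]
    rw [← hdec, hv, smul_smul, mul_inv_cancel₀ hr.ne', one_smul]
  -- its derivative
  set γ' : ℝ → (EuclideanSpace ℝ (Fin 3)) := fun t =>
    r • ((-Real.sin (θ * t) * θ) • u + (Real.cos (θ * t) * θ) • w) with hγ'
  have hγd : ∀ t, HasDerivAt γ (γ' t) t := by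
    intro t
    have h1 : HasDerivAt (fun s => θ * s) θ t := by
      simpa using (hasDerivAt_id t).const_mul θ
    have hc : HasDerivAt (fun s => Real.cos (θ * s)) (-Real.sin (θ * t) * θ) t :=
      (Real.hasDerivAt_cos (θ * t)).comp t h1
    have hs : HasDerivAt (fun s => Real.sin (θ * s)) (Real.cos (θ * t) * θ) t :=
      (Real.hasDerivAt_sin (θ * t)).comp t h1
    have h2 := ((hc.smul_const u).add (hs.smul_const w)).const_smul r
    exact h2
  have hγ'n : ∀ t, ‖γ' t‖ ≤ 8 * r := by
    intro t
    rw [hγ']; simp only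
    rw [norm_smul, Real.norm_of_nonneg hr.le, mul_comm]
    refine mul_le_mul_of_nonneg_right ?_ hr.le
    calc ‖(-Real.sin (θ * t) * θ) • u + (Real.cos (θ * t) * θ) • w‖
        ≤ ‖(-Real.sin (θ * t) * θ) • u‖ + ‖(Real.cos (θ * t) * θ) • w‖ := norm_add_le _ _
      _ = |Real.sin (θ * t)| * θ + |Real.cos (θ * t)| * θ := by
          rw [norm_smul, norm_smul, hun, hw, mul_one, mul_one, Real.norm_eq_abs, Real.norm_eq_abs,
            abs_mul, abs_mul, abs_neg, abs_of_nonneg hθ0]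
      _ ≤ 1 * Real.pi + 1 * Real.pi := by
          gcongr
          · exact Real.abs_sin_le_one _
          · exact Real.abs_cos_le_one _
      _ ≤ 8 := by nlinarith [Real.pi_le_four]
  -- the composite
  have hφ : ∀ t ∈ Icc (0 : ℝ) 1, HasDerivWithinAt (fun t => f (γ t)) (fderiv ℝ f (γ t) (γ' t)) (Icc 0 1) t :=
    fun t _ => ((hf (γ t)).hasFDerivAt.comp_hasDerivAt t (hγd t)).hasDerivWithinAt
  have hbound : ∀ t ∈ Ico (0 : ℝ) 1, ‖fderiv ℝ f (γ t) (γ' t)‖ ≤ G * (8 * r) := by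
    intro t _
    calc ‖fderiv ℝ f (γ t) (γ' t)‖ ≤ ‖fderiv ℝ f (γ t)‖ * ‖γ' t‖ := ContinuousLinearMap.le_opNorm _ _
      _ ≤ G * (8 * r) := mul_le_mul (hG _ (hS _ (hγn t))) (hγ'n t) (norm_nonneg _) hG0
  have h := norm_image_sub_le_of_norm_deriv_le_segment_01' hφ hbound
  rw [hγ1, hγ0, Real.norm_eq_abs, abs_sub_comm] at h
  exact h

/-- **Mean value bound along a radius**: if `‖Df‖ ≤ G` on the shell `a ≤ ‖x‖ ≤ b` then for `x` in
the shell and `r ∈ [a, b]`, `|f x − f ((r/‖x‖)x)| ≤ G (b − a)`. [folklore] -/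
theorem abs_sub_le_of_radial {f : (EuclideanSpace ℝ (Fin 3)) → ℝ} (hf : Differentiable ℝ f) {a b G : ℝ} (ha : 0 < a)
    (hG : ∀ x : (EuclideanSpace ℝ (Fin 3)), a ≤ ‖x‖ → ‖x‖ ≤ b → ‖fderiv ℝ f x‖ ≤ G) {x : (EuclideanSpace ℝ (Fin 3))} (hxa : a ≤ ‖x‖) (hxb : ‖x‖ ≤ b)
    {r : ℝ} (hra : a ≤ r) (hrb : r ≤ b) :
    |f x - f ((r / ‖x‖) • x)| ≤ G * (b - a) := by
  have hx0 : 0 < ‖x‖ := ha.trans_le hxa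
  have hG0 : 0 ≤ G := (norm_nonneg _).trans (hG x hxa hxb)
  set x' : (EuclideanSpace ℝ (Fin 3)) := (r / ‖x‖) • x with hx'
  -- the segment stays in the shell
  have hseg : ∀ z ∈ segment ℝ x x', a ≤ ‖z‖ ∧ ‖z‖ ≤ b := by
    intro z hz
    rw [segment_eq_image] at hz
    obtain ⟨t, ⟨ht0, ht1⟩, rfl⟩ := hz
    have hcomb : (1 - t) • x + t • x' = ((1 - t) + t * (r / ‖x‖)) • x := by
      rw [hx', smul_smul, ← add_smul]
    have hcoef : 0 ≤ (1 - t) + t * (r / ‖x‖) := by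
      have h1 : 0 ≤ 1 - t := by linarith
      have h2 : 0 ≤ t * (r / ‖x‖) := mul_nonneg ht0 (div_nonneg (ha.le.trans hra) (norm_nonneg _))
      linarith
    simp only [hcomb, norm_smul, Real.norm_of_nonneg hcoef]
    have e : ((1 - t) + t * (r / ‖x‖)) * ‖x‖ = (1 - t) * ‖x‖ + t * r := by
      field_simp
    rw [e]
    constructor <;> nlinarith
  have hmvt := Convex.norm_image_sub_le_of_norm_fderiv_le (f := f) (fun z _ => hf z)
    (fun z hz => hG z (hseg z hz).1 (hseg z hz).2) (convex_segment x x')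
    (left_mem_segment ℝ x x') (right_mem_segment ℝ x x')
  rw [Real.norm_eq_abs, abs_sub_comm] at hmvt
  refine hmvt.trans (mul_le_mul_of_nonneg_left ?_ hG0)
  have hdiff : x' - x = (r / ‖x‖ - 1) • x := by rw [hx', sub_smul, one_smul]
  rw [hdiff, norm_smul, Real.norm_eq_abs]
  have e : |r / ‖x‖ - 1| * ‖x‖ = |r - ‖x‖| := by
    rw [← abs_of_pos hx0, ← abs_mul, abs_of_pos hx0]
    congr 1; field_simp
  rw [e]
  exact abs_sub_le_iff.2 ⟨by linarith, by linarith⟩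

/-- **Oscillation over a spherical shell**: if `‖Df‖ ≤ G` on `a ≤ ‖x‖ ≤ b` (`0 < a ≤ b`) then
`|f x − f y| ≤ 9 G b` for all `x, y` in the shell (radius, then great circle). [folklore] -/
theorem abs_sub_le_of_shell {f : (EuclideanSpace ℝ (Fin 3)) → ℝ} (hf : Differentiable ℝ f) {a b G : ℝ} (ha : 0 < a)
    (hG : ∀ x : (EuclideanSpace ℝ (Fin 3)), a ≤ ‖x‖ → ‖x‖ ≤ b → ‖fderiv ℝ f x‖ ≤ G) {x y : (EuclideanSpace ℝ (Fin 3))} (hxa : a ≤ ‖x‖)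
    (hxb : ‖x‖ ≤ b) (hya : a ≤ ‖y‖) (hyb : ‖y‖ ≤ b) : |f x - f y| ≤ G * (9 * b) := by
  have hG0 : 0 ≤ G := (norm_nonneg _).trans (hG x hxa hxb)
  have hx0 : 0 < ‖x‖ := ha.trans_le hxa
  have hy0 : 0 < ‖y‖ := ha.trans_le hya
  set x' : (EuclideanSpace ℝ (Fin 3)) := (‖y‖ / ‖x‖) • x with hx'
  have hx'n : ‖x'‖ = ‖y‖ := by
    rw [hx', norm_smul, Real.norm_of_nonneg (by positivity), div_mul_cancel₀ _ hx0.ne']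
  have h1 : |f x - f x'| ≤ G * (b - a) := abs_sub_le_of_radial hf ha hG hxa hxb hya hyb
  have h2 : |f x' - f y| ≤ G * (8 * ‖y‖) :=
    abs_sub_le_of_sphere hf (S := {z : (EuclideanSpace ℝ (Fin 3)) | a ≤ ‖z‖ ∧ ‖z‖ ≤ b}) (fun z hz => hG z hz.1 hz.2) hy0
      (fun z hz => ⟨hz ▸ hya, hz ▸ hyb⟩) hx'n rfl
  calc |f x - f y| = |(f x - f x') + (f x' - f y)| := by ring_nf
    _ ≤ |f x - f x'| + |f x' - f y| := abs_add_le _ _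
    _ ≤ G * (b - a) + G * (8 * ‖y‖) := add_le_add h1 h2
    _ ≤ G * (9 * b) := by nlinarith [mul_le_mul_of_nonneg_left hyb hG0]

end Geometry




/-! ### §5. Smooth cut-offs adapted to spherical shells -/

section ShellCutoff

/-- **A smooth shell cut-off**: for `0 < α₁ < α₂ ≤ β₁ < β₂` there is `χ ∈ C_c^∞((EuclideanSpace ℝ (Fin 3)); [0,1])` equal to
`1` on `α₂ ≤ ‖x‖ ≤ β₁` and vanishing off `α₁ < ‖x‖ < β₂` (product of a ball bump and the
complement of a smaller ball bump). [folklore] -/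
theorem exists_shell_cutoff {α₁ α₂ β₁ β₂ : ℝ} (h0 : 0 < α₁) (h1 : α₁ < α₂) (h2 : α₂ ≤ β₁)
    (h3 : β₁ < β₂) :
    ∃ χ : (EuclideanSpace ℝ (Fin 3)) → ℝ, ContDiff ℝ ∞ χ ∧ HasCompactSupport χ ∧ (∀ x, 0 ≤ χ x ∧ χ x ≤ 1) ∧
      (∀ x, α₂ ≤ ‖x‖ → ‖x‖ ≤ β₁ → χ x = 1) ∧ (∀ x, χ x ≠ 0 → α₁ < ‖x‖ ∧ ‖x‖ < β₂) ∧
      tsupport χ ⊆ {x | α₁ ≤ ‖x‖ ∧ ‖x‖ ≤ β₂} := by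
  let fin : ContDiffBump (0 : (EuclideanSpace ℝ (Fin 3))) := ⟨α₁, α₂, h0, h1⟩
  let fout : ContDiffBump (0 : (EuclideanSpace ℝ (Fin 3))) := ⟨β₁, β₂, h0.trans (h1.trans_le h2), h3⟩
  refine ⟨fun y => fout y * (1 - fin y), ?_, ?_, fun x => ?_, fun x hxa hxb => ?_, fun x hx => ?_, ?_⟩
  · exact fout.contDiff.mul (contDiff_const.sub fin.contDiff)
  · exact fout.hasCompactSupport.mul_right
  · exact ⟨mul_nonneg fout.nonneg (sub_nonneg.2 fin.le_one),
      mul_le_one₀ fout.le_one (sub_nonneg.2 fin.le_one) (sub_le_self _ fin.nonneg)⟩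
  · have h1' : fout x = 1 := fout.one_of_mem_closedBall (by simpa using hxb)
    have h2' : fin x = 0 := fin.zero_of_le_dist (by simpa using hxa)
    simp [h1', h2']
  · have hout : fout x ≠ 0 := left_ne_zero_of_mul hx
    have hin : fin x ≠ 1 := fun h => hx (by simp [h])
    constructor
    · by_contra hle
      exact hin (fin.one_of_mem_closedBall (by simpa using not_lt.1 hle))
    · by_contra hle
      exact hout (fout.zero_of_le_dist (by simpa using not_lt.1 hle))
  · have hcl : IsClosed {x : (EuclideanSpace ℝ (Fin 3)) | α₁ ≤ ‖x‖ ∧ ‖x‖ ≤ β₂} := by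
      have : {x : (EuclideanSpace ℝ (Fin 3)) | α₁ ≤ ‖x‖ ∧ ‖x‖ ≤ β₂} = (fun x : (EuclideanSpace ℝ (Fin 3)) => ‖x‖) ⁻¹' Icc α₁ β₂ := rfl
      rw [this]; exact isClosed_Icc.preimage continuous_norm
    refine closure_minimal (fun x hx => ?_) hcl
    rw [mem_support] at hx
    have hout : fout x ≠ 0 := left_ne_zero_of_mul hx
    have hin : fin x ≠ 1 := fun h => hx (by simp [h])
    constructor
    · by_contra hle
      exact hin (fin.one_of_mem_closedBall (by simpa using (not_le.1 hle).le))
    · by_contra hle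
      exact hout (fout.zero_of_le_dist (by simpa using (not_le.1 hle).le))

end ShellCutoff

/-! ### §6. The pressure oscillation over a shell at unit scale -/

section UnitScale

variable {ν : ℝ} {p : ℝ≥0∞}

/-- The open spherical shell `a < ‖x‖ < b` is measurable. [folklore] -/
theorem measurableSet_shell_open (a b : ℝ) : MeasurableSet {x : (EuclideanSpace ℝ (Fin 3)) | a < ‖x‖ ∧ ‖x‖ < b} := by
  have : {x : (EuclideanSpace ℝ (Fin 3)) | a < ‖x‖ ∧ ‖x‖ < b} = (fun x : (EuclideanSpace ℝ (Fin 3)) => ‖x‖) ⁻¹' Ioo a b := rfl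
  rw [this]
  exact (isOpen_Ioo.preimage continuous_norm).measurableSet

/-- The open spherical shell `a < ‖x‖ < b` is open. [folklore] -/
theorem isOpen_shell (a b : ℝ) : IsOpen {x : (EuclideanSpace ℝ (Fin 3)) | a < ‖x‖ ∧ ‖x‖ < b} := by
  have : {x : (EuclideanSpace ℝ (Fin 3)) | a < ‖x‖ ∧ ‖x‖ < b} = (fun x : (EuclideanSpace ℝ (Fin 3)) => ‖x‖) ⁻¹' Ioo a b := rfl
  rw [this]
  exact isOpen_Ioo.preimage continuous_norm

/-- The closed spherical shell `a ≤ ‖x‖ ≤ b` is measurable. [folklore] -/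
theorem measurableSet_shell_closed (a b : ℝ) : MeasurableSet {x : (EuclideanSpace ℝ (Fin 3)) | a ≤ ‖x‖ ∧ ‖x‖ ≤ b} := by
  have : {x : (EuclideanSpace ℝ (Fin 3)) | a ≤ ‖x‖ ∧ ‖x‖ ≤ b} = (fun x : (EuclideanSpace ℝ (Fin 3)) => ‖x‖) ⁻¹' Icc a b := rfl
  rw [this]
  exact (isClosed_Icc.preimage continuous_norm).measurableSet

/-- The closed spherical shell has finite volume. [folklore] -/
theorem volume_shell_closed_lt_top (a b : ℝ) : volume {x : (EuclideanSpace ℝ (Fin 3)) | a ≤ ‖x‖ ∧ ‖x‖ ≤ b} < ⊤ :=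
  (measure_mono (fun _ hx => mem_closedBall_zero_iff.2 hx.2)).trans_lt
    (measure_closedBall_lt_top (x := (0 : (EuclideanSpace ℝ (Fin 3)))) (r := b))

/-- **The pressure oscillation over a shell (unit scale).** For `ν > 0`, `1 < p < ∞` and radii
`0 < a₁ < a₂ ≤ b₂ < b₁` there is `C` such that every smooth steady profile `(U, P)` admits a
constant `c` with
`‖P − c‖_{L^p(a₂ ≤ |x| ≤ b₂)} ≤ C (‖U‖_{L^p(a₁<|x|<b₁)} + ‖U‖²_{L^{2p}(a₁<|x|<b₁)})`
(Tsai 2021, Lemma 3.2 / display (3.5) at `R = 1`: `p₁ ∈ L^p` by Step 3 and the oscillation of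
`P − p₁` over the shell from the gradient bound, `|P − p₁ − c| ≤ 9 b₂ sup|∇(P − p₁)|`).
[cite: Tsai2021, Lemma 3.2 and (3.5)] -/
theorem pressure_osc_shell (hν : 0 < ν) (hp : 1 < p) (hp' : p < ⊤) {a₁ a₂ b₂ b₁ : ℝ}
    (ha₁ : 0 < a₁) (h12 : a₁ < a₂) (hab : a₂ ≤ b₂) (h21 : b₂ < b₁) :
    ∃ C : ℝ≥0, ∀ (U : (EuclideanSpace ℝ (Fin 3)) → (EuclideanSpace ℝ (Fin 3))) (P : (EuclideanSpace ℝ (Fin 3)) → ℝ), IsLerayProfile ν 0 U P → ContDiff ℝ ∞ U →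
      ∃ c : ℝ, eLpNorm (fun x => P x - c) p (volume.restrict {x : (EuclideanSpace ℝ (Fin 3)) | a₂ ≤ ‖x‖ ∧ ‖x‖ ≤ b₂}) ≤
        C * (eLpNorm U p (volume.restrict {x : (EuclideanSpace ℝ (Fin 3)) | a₁ < ‖x‖ ∧ ‖x‖ < b₁}) +
          eLpNorm U (2 * p) (volume.restrict {x : (EuclideanSpace ℝ (Fin 3)) | a₁ < ‖x‖ ∧ ‖x‖ < b₁}) ^ (2 : ℝ)) := by
  -- geometry of the cut-offs
  set g : ℝ := min (a₂ - a₁) (b₁ - b₂) / 5 with hg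
  have hg0 : 0 < g := by
    rw [hg]; exact div_pos (lt_min (by linarith) (by linarith)) (by norm_num)
  have hga : 5 * g ≤ a₂ - a₁ := by
    have := min_le_left (a₂ - a₁) (b₁ - b₂); rw [hg]; linarith
  have hgb : 5 * g ≤ b₁ - b₂ := by
    have := min_le_right (a₂ - a₁) (b₁ - b₂); rw [hg]; linarith
  obtain ⟨χ₁, hχ₁, hχ₁c, hχ₁01, hχ₁one, hχ₁nz, hχ₁supp⟩ :=
    exists_shell_cutoff (α₁ := a₁ + g) (α₂ := a₁ + 2 * g) (β₁ := b₁ - 2 * g) (β₂ := b₁ - g)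
      (by linarith) (by linarith) (by linarith) (by linarith)
  obtain ⟨χ, hχ, hχc, hχ01, hχone, hχnz, hχsupp⟩ :=
    exists_shell_cutoff (α₁ := a₁ + 3 * g) (α₂ := a₁ + 4 * g) (β₁ := b₁ - 4 * g) (β₂ := b₁ - 3 * g)
      (by linarith) (by linarith) (by linarith) (by linarith)
  set K : Set (EuclideanSpace ℝ (Fin 3)) := {x | a₁ < ‖x‖ ∧ ‖x‖ < b₁} with hK
  have hKm : MeasurableSet K := measurableSet_shell_open a₁ b₁
  have hχ₁K : tsupport χ₁ ⊆ K := hχ₁supp.trans fun x hx => ⟨by linarith [hx.1], by linarith [hx.2]⟩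
  have hχχ₁ : ∀ x, χ x ≠ 0 → χ₁ x = 1 := fun x hx =>
    hχ₁one x (by linarith [(hχnz x hx).1]) (by linarith [(hχnz x hx).2])
  have hχle : ∀ x, |χ x| ≤ 1 := fun x => abs_le.2 ⟨by linarith [(hχ01 x).1], (hχ01 x).2⟩
  set O : Set (EuclideanSpace ℝ (Fin 3)) := {x | a₁ + 4 * g < ‖x‖ ∧ ‖x‖ < b₁ - 4 * g} with hO
  have hOo : IsOpen O := isOpen_shell _ _
  have hχO : ∀ x ∈ O, χ x = 1 := fun x hx => hχone x hx.1.le hx.2.le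
  set A : Set (EuclideanSpace ℝ (Fin 3)) := {x | a₂ ≤ ‖x‖ ∧ ‖x‖ ≤ b₂} with hA
  set r₁ : ℝ := g / 4 with hr₁
  set r₀ : ℝ := g / 8 with hr₀
  have h₀ : 0 < r₀ := by rw [hr₀]; positivity
  have h₁ : r₀ < r₁ := by rw [hr₀, hr₁]; linarith
  have hAO : ∀ x ∈ A, closedBall x (r₁ + r₁) ⊆ O := by
    intro x hx y hy
    rw [mem_closedBall, dist_eq_norm] at hy
    have h1 : ‖x‖ - ‖y - x‖ ≤ ‖y‖ := by
      have := norm_sub_norm_le x (x - y)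
      rw [sub_sub_cancel, norm_sub_rev] at this
      linarith
    have h2 : ‖y‖ ≤ ‖x‖ + ‖y - x‖ := by
      have := norm_add_le x (y - x); rwa [add_sub_cancel] at this
    constructor
    · linarith [hx.1]
    · linarith [hx.2]
  obtain ⟨C, hC⟩ := pressure_gradient_bound hν h₀ h₁ hp hp' hχ₁ hχ₁c hχ hχc hKm hχ₁K hχχ₁ hχle
    hOo hχO hAO
  -- the constant
  have hvolA : volume A < ⊤ := volume_shell_closed_lt_top a₂ b₂
  set V : ℝ≥0∞ := (volume A) ^ p.toReal⁻¹ with hV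
  have hVtop : V ≠ ⊤ := ENNReal.rpow_ne_top_of_nonneg (inv_nonneg.2 ENNReal.toReal_nonneg) hvolA.ne
  set E : ℝ≥0∞ := C * (1 + V * ENNReal.ofReal (9 * b₂)) + 1 with hE
  have hEtop : E ≠ ⊤ := ENNReal.add_ne_top.2 ⟨ENNReal.mul_ne_top ENNReal.coe_ne_top
    (ENNReal.add_ne_top.2 ⟨ENNReal.one_ne_top, ENNReal.mul_ne_top hVtop ENNReal.ofReal_ne_top⟩),
    ENNReal.one_ne_top⟩
  have hE0 : E ≠ 0 := by rw [hE]; exact ne_of_gt (lt_of_lt_of_le zero_lt_one le_add_self)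
  refine ⟨E.toNNReal, fun U P hprof hU => ?_⟩
  rw [ENNReal.coe_toNNReal hEtop]
  obtain ⟨p₁, hp₁s, hp₁B, hgrad⟩ := hC U P hprof hU
  set B : ℝ≥0∞ := eLpNorm U p (volume.restrict K) + eLpNorm U (2 * p) (volume.restrict K) ^ (2 : ℝ)
    with hB
  -- the trivial case `B = ∞`
  by_cases hBtop : B = ⊤
  · refine ⟨0, ?_⟩
    rw [hBtop, ENNReal.mul_top hE0]
    exact le_top
  -- the reference point and the constant `c`
  set x₀ : (EuclideanSpace ℝ (Fin 3)) := a₂ • ((EuclideanSpace.single (0 : Fin 3) (1 : ℝ))) with hx₀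
  have hx₀n : ‖x₀‖ = a₂ := by
    rw [hx₀, norm_smul, norm_single_one, mul_one, Real.norm_of_nonneg (by linarith)]
  have hx₀A : x₀ ∈ A := ⟨by rw [hx₀n], by rw [hx₀n]; exact hab⟩
  set h : (EuclideanSpace ℝ (Fin 3)) → ℝ := fun y => P y - p₁ y with hh
  have hP : ContDiff ℝ ∞ P := contDiff_pressure_top hprof hU
  have hhd : Differentiable ℝ h := (hP.sub hp₁s).differentiable (by norm_cast)
  set G : ℝ := (C * B).toReal with hG
  have hCB : (C : ℝ≥0∞) * B ≠ ⊤ := ENNReal.mul_ne_top ENNReal.coe_ne_top hBtop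
  have hgradG : ∀ x : (EuclideanSpace ℝ (Fin 3)), a₂ ≤ ‖x‖ → ‖x‖ ≤ b₂ → ‖fderiv ℝ h x‖ ≤ G := by
    intro x hxa hxb
    have hx : x ∈ A := ⟨hxa, hxb⟩
    have := hgrad x hx
    rw [← ofReal_norm] at this
    exact (ENNReal.ofReal_le_iff_le_toReal hCB).1 this
  refine ⟨h x₀, ?_⟩
  -- `P − c = p₁ + (h − h x₀)`
  have hsplit : (fun x => P x - h x₀) = fun x => p₁ x + (h x - h x₀) := by
    funext x; simp only [hh]; ring
  rw [hsplit]
  have hm1 : AEStronglyMeasurable p₁ (volume.restrict A) := hp₁s.continuous.aestronglyMeasurable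
  have hm2 : AEStronglyMeasurable (fun x => h x - h x₀) (volume.restrict A) :=
    ((hP.sub hp₁s).continuous.sub continuous_const).aestronglyMeasurable
  refine (eLpNorm_add_le hm1 hm2 hp.le).trans ?_
  have hosc : eLpNorm (fun x => h x - h x₀) p (volume.restrict A) ≤ V * ENNReal.ofReal (G * (9 * b₂)) := by
    have hae : ∀ᵐ x ∂(volume.restrict A), ‖h x - h x₀‖ ≤ G * (9 * b₂) := by
      rw [ae_restrict_iff' (measurableSet_shell_closed a₂ b₂)]
      exact Eventually.of_forall fun x hx =>
        (Real.norm_eq_abs _).trans_le (abs_sub_le_of_shell hhd (ha₁.trans h12) hgradG hx.1 hx.2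
          (by rw [hx₀n]) (by rw [hx₀n]; exact hab))
    refine (eLpNorm_le_of_ae_bound hae).trans ?_
    rw [Measure.restrict_apply_univ]
  calc eLpNorm p₁ p (volume.restrict A) + eLpNorm (fun x => h x - h x₀) p (volume.restrict A)
      ≤ C * B + V * ENNReal.ofReal (G * (9 * b₂)) :=
        add_le_add ((eLpNorm_restrict_le _ _ _ _).trans hp₁B) hosc
    _ = C * B + V * (C * B * ENNReal.ofReal (9 * b₂)) := by
        rw [ENNReal.ofReal_mul ENNReal.toReal_nonneg, ENNReal.ofReal_toReal hCB]
    _ = C * (1 + V * ENNReal.ofReal (9 * b₂)) * B := by ring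
    _ ≤ E * B := by rw [hE]; gcongr; exact le_self_add

end UnitScale

/-! ### §7. Scaling `x ↦ Rx` -/

section Scaling

open scoped Pointwise

variable {ν : ℝ} {p : ℝ≥0∞}

/-- **Change of variables `x ↦ Rx` in a set lintegral** on `(EuclideanSpace ℝ (Fin 3))`:
`∫_{s} g(Rx) dx = R⁻³ ∫_{R•s} g`. [folklore] -/
theorem lintegral_comp_smul_set (g : (EuclideanSpace ℝ (Fin 3)) → ℝ≥0∞) {R : ℝ} (hR : 0 < R) {s : Set (EuclideanSpace ℝ (Fin 3))}
    (hs : MeasurableSet s) :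
    ∫⁻ x in s, g (R • x) = ENNReal.ofReal ((R ^ 3)⁻¹) * ∫⁻ x in R • s, g x := by
  have hR0 : R ≠ 0 := hR.ne'
  let e : (EuclideanSpace ℝ (Fin 3)) ≃ᵐ (EuclideanSpace ℝ (Fin 3)) := (Homeomorph.smul (Units.mk0 R hR0)).toMeasurableEquiv
  have he : ∀ x : (EuclideanSpace ℝ (Fin 3)), e x = R • x := fun x => rfl
  have hsm : MeasurableSet (R • s) := hs.const_smul_of_ne_zero hR0
  have hind : ∀ x : (EuclideanSpace ℝ (Fin 3)), s.indicator (fun y => g (R • y)) x = (R • s).indicator g (R • x) := by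
    intro x
    by_cases hx : x ∈ s
    · rw [indicator_of_mem hx, indicator_of_mem (smul_mem_smul_set hx)]
    · rw [indicator_of_notMem hx, indicator_of_notMem]
      rwa [Set.smul_mem_smul_set_iff₀ hR0]
  calc ∫⁻ x in s, g (R • x) = ∫⁻ x, s.indicator (fun y => g (R • y)) x := (lintegral_indicator hs _).symm
    _ = ∫⁻ x, (R • s).indicator g (e x) := lintegral_congr fun x => by rw [hind, he]
    _ = ∫⁻ y, (R • s).indicator g y ∂(Measure.map e volume) := (lintegral_map_equiv _ e).symm
    _ = ∫⁻ y, (R • s).indicator g y ∂(ENNReal.ofReal |(R ^ Module.finrank ℝ (EuclideanSpace ℝ (Fin 3)))⁻¹| • volume) := by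
        have hmap : Measure.map (e : (EuclideanSpace ℝ (Fin 3)) → (EuclideanSpace ℝ (Fin 3))) volume = Measure.map (fun x : (EuclideanSpace ℝ (Fin 3)) => R • x) volume := by
          congr 1
        rw [hmap, Measure.map_addHaar_smul volume hR0]
    _ = ENNReal.ofReal ((R ^ 3)⁻¹) * ∫⁻ x in R • s, g x := by
        rw [lintegral_smul_measure, lintegral_indicator hsm, finrank_euclideanSpace_fin,
          abs_of_nonneg (inv_nonneg.2 (pow_nonneg hR.le 3)), smul_eq_mul]

/-- **Change of variables `x ↦ Rx` in `L^q` norms over sets**, `0 < q < ∞`: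
`‖f(R·)‖_{L^q(s)} = R^{-3/q} ‖f‖_{L^q(R•s)}`. [folklore] -/
theorem eLpNorm_comp_smul_set {F : Type*} [NormedAddCommGroup F] (f : (EuclideanSpace ℝ (Fin 3)) → F) {R : ℝ} (hR : 0 < R)
    {s : Set (EuclideanSpace ℝ (Fin 3))} (hs : MeasurableSet s) {q : ℝ≥0∞} (hq0 : q ≠ 0) (hq : q ≠ ⊤) :
    eLpNorm (fun x => f (R • x)) q (volume.restrict s) =
      ENNReal.ofReal ((R ^ 3)⁻¹) ^ (1 / q.toReal) * eLpNorm f q (volume.restrict (R • s)) := by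
  rw [eLpNorm_eq_lintegral_rpow_enorm_toReal hq0 hq, eLpNorm_eq_lintegral_rpow_enorm_toReal hq0 hq,
    lintegral_comp_smul_set (fun x => ‖f x‖ₑ ^ q.toReal) hR hs,
    ENNReal.mul_rpow_of_nonneg _ _ (by positivity)]

/-- Dilates of open shells: `R • {a < ‖x‖ < b} = {aR < ‖x‖ < bR}` for `R > 0`. [folklore] -/
theorem smul_shell_open {R : ℝ} (hR : 0 < R) (a b : ℝ) :
    R • {x : (EuclideanSpace ℝ (Fin 3)) | a < ‖x‖ ∧ ‖x‖ < b} = {x : (EuclideanSpace ℝ (Fin 3)) | a * R < ‖x‖ ∧ ‖x‖ < b * R} := by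
  ext y
  rw [Set.mem_smul_set_iff_inv_smul_mem₀ hR.ne', mem_setOf_eq, mem_setOf_eq, norm_smul, norm_inv,
    Real.norm_of_nonneg hR.le, ← div_eq_inv_mul, lt_div_iff₀ hR, div_lt_iff₀ hR]

/-- Dilates of closed shells: `R • {a ≤ ‖x‖ ≤ b} = {aR ≤ ‖x‖ ≤ bR}` for `R > 0`. [folklore] -/
theorem smul_shell_closed {R : ℝ} (hR : 0 < R) (a b : ℝ) :
    R • {x : (EuclideanSpace ℝ (Fin 3)) | a ≤ ‖x‖ ∧ ‖x‖ ≤ b} = {x : (EuclideanSpace ℝ (Fin 3)) | a * R ≤ ‖x‖ ∧ ‖x‖ ≤ b * R} := by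
  ext y
  rw [Set.mem_smul_set_iff_inv_smul_mem₀ hR.ne', mem_setOf_eq, mem_setOf_eq, norm_smul, norm_inv,
    Real.norm_of_nonneg hR.le, ← div_eq_inv_mul, le_div_iff₀ hR, div_le_iff₀ hR]

/-- **Scaling of steady profiles**: if `(U, P)` is a steady profile then so is
`(R U(R·), R² P(R·))`, `R > 0` (each term of the system scales by `R³`). [cite: Tsai2021, §3 ("We may assume R = 1 by scaling")] -/
theorem isLerayProfile_scale {U : (EuclideanSpace ℝ (Fin 3)) → (EuclideanSpace ℝ (Fin 3))} {P : (EuclideanSpace ℝ (Fin 3)) → ℝ} (hprof : IsLerayProfile ν 0 U P) {R : ℝ}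
    (hR : 0 < R) : IsLerayProfile ν 0 (fun x => R • U (R • x)) (fun x => R ^ 2 * P (R • x)) := by
  have hR0 : R ≠ 0 := hR.ne'
  have hfd : fderiv ℝ (fun x => R • U (R • x)) = fun z => (R * R) • fderiv ℝ U (R • z) :=
    fderiv_const_smul_comp_smul U R hR0
  have hPs : (fun x => R ^ 2 * P (R • x)) = fun x => R ^ 2 • P (R • x) := rfl
  refine ⟨?_, ?_, fun y => ?_, fun y => ?_⟩
  · exact (hprof.contDiff_velocity.comp (contDiff_const_smul R)).const_smul R
  · exact contDiff_const.mul (hprof.contDiff_pressure.comp (contDiff_const_smul R))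
  · have key := hprof.profile_eq (R • y)
    simp only [zero_smul, add_zero] at key ⊢
    have hΔ : (Δ fun x => R • U (R • x)) y = (R * R ^ 2) • (Δ U) (R • y) :=
      laplacian_const_smul_comp_smul U R hR0 y
    have hconv : convect (fun x => R • U (R • x)) (fun x => R • U (R • x)) y =
        (R * R * R) • convect U U (R • y) := by
      simp only [convect_apply, hfd, FunLike.coe_smul, Pi.smul_apply, map_smul, smul_smul]
      congr 1; ring
    have hgrad : gradient (fun x => R ^ 2 * P (R • x)) y = (R ^ 2 * R) • gradient P (R • y) := by
      rw [hPs, gradient, gradient, congrFun (fderiv_const_smul_comp_smul P (R ^ 2) hR0) y,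
        LinearIsometryEquiv.map_smul]
    rw [hΔ, hconv, hgrad]
    have e1 : R * R ^ 2 = R ^ 3 := by ring
    have e2 : R * R * R = R ^ 3 := by ring
    have e3 : R ^ 2 * R = R ^ 3 := by ring
    rw [e1, e2, e3, smul_comm ν (R ^ 3), ← smul_neg, ← smul_add, ← smul_add, key, smul_zero]
  · unfold VectorCalculus.divergence
    rw [congrFun hfd y, ContinuousLinearMap.toLinearMap_smul, map_smul, smul_eq_mul]
    have := hprof.divFree (R • y)
    unfold VectorCalculus.divergence at this
    rw [this, mul_zero]

/-- **The pressure oscillation over a shell at scale `R`** (Tsai 2021, Lemma 3.2 / (3.5) with the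
radii ratio fixed): for `ν > 0`, `1 < p < ∞` and radii `0 < a₁ < a₂ ≤ b₂ < b₁` there is `C` such
that for every `R > 0` and every smooth steady profile `(U, P)` there is a constant `c` with
`‖P − c‖_{L^p(a₂R ≤ |x| ≤ b₂R)} ≤ C (R⁻¹‖U‖_{L^p(a₁R<|x|<b₁R)} + ‖U‖²_{L^{2p}(a₁R<|x|<b₁R)})`
(unit scale applied to `(RU(R·), R²P(R·))` and the change of variables `x ↦ Rx`).
[cite: Tsai2021, Lemma 3.2 and (3.5)] -/
theorem pressure_osc_shell_scaled (hν : 0 < ν) (hp : 1 < p) (hp' : p < ⊤) {a₁ a₂ b₂ b₁ : ℝ}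
    (ha₁ : 0 < a₁) (h12 : a₁ < a₂) (hab : a₂ ≤ b₂) (h21 : b₂ < b₁) :
    ∃ C : ℝ≥0, ∀ R : ℝ, 0 < R → ∀ (U : (EuclideanSpace ℝ (Fin 3)) → (EuclideanSpace ℝ (Fin 3))) (P : (EuclideanSpace ℝ (Fin 3)) → ℝ), IsLerayProfile ν 0 U P →
      ContDiff ℝ ∞ U → ∃ c : ℝ,
        eLpNorm (fun x => P x - c) p (volume.restrict {x : (EuclideanSpace ℝ (Fin 3)) | a₂ * R ≤ ‖x‖ ∧ ‖x‖ ≤ b₂ * R}) ≤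
          C * (ENNReal.ofReal R⁻¹ * eLpNorm U p (volume.restrict {x : (EuclideanSpace ℝ (Fin 3)) | a₁ * R < ‖x‖ ∧ ‖x‖ < b₁ * R}) +
            eLpNorm U (2 * p) (volume.restrict {x : (EuclideanSpace ℝ (Fin 3)) | a₁ * R < ‖x‖ ∧ ‖x‖ < b₁ * R}) ^ (2 : ℝ)) := by
  obtain ⟨C, hC⟩ := pressure_osc_shell hν hp hp' ha₁ h12 hab h21
  refine ⟨C, fun R hR U P hprof hU => ?_⟩
  have hR0 : R ≠ 0 := hR.ne'
  have hp0 : p ≠ 0 := (zero_lt_one.trans hp).ne'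
  have hptop : p ≠ ⊤ := hp'.ne
  have h2p0 : 2 * p ≠ 0 := mul_ne_zero two_ne_zero hp0
  have h2ptop : 2 * p ≠ ⊤ := ENNReal.mul_ne_top (by norm_num) hptop
  -- the rescaled profile
  set U' : (EuclideanSpace ℝ (Fin 3)) → (EuclideanSpace ℝ (Fin 3)) := fun x => R • U (R • x) with hU'
  set P' : (EuclideanSpace ℝ (Fin 3)) → ℝ := fun x => R ^ 2 * P (R • x) with hP'
  have hprof' : IsLerayProfile ν 0 U' P' := isLerayProfile_scale hprof hR
  have hU's : ContDiff ℝ ∞ U' := (hU.comp (contDiff_const_smul R)).const_smul R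
  obtain ⟨c', hc'⟩ := hC U' P' hprof' hU's
  refine ⟨c' / R ^ 2, ?_⟩
  -- names for the sets and the Jacobian factor
  set A₁ : Set (EuclideanSpace ℝ (Fin 3)) := {x | a₂ ≤ ‖x‖ ∧ ‖x‖ ≤ b₂} with hA₁
  set K₁ : Set (EuclideanSpace ℝ (Fin 3)) := {x | a₁ < ‖x‖ ∧ ‖x‖ < b₁} with hK₁
  have hA₁m : MeasurableSet A₁ := measurableSet_shell_closed a₂ b₂
  have hK₁m : MeasurableSet K₁ := measurableSet_shell_open a₁ b₁
  have hAR : R • A₁ = {x : (EuclideanSpace ℝ (Fin 3)) | a₂ * R ≤ ‖x‖ ∧ ‖x‖ ≤ b₂ * R} := smul_shell_closed hR a₂ b₂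
  have hKR : R • K₁ = {x : (EuclideanSpace ℝ (Fin 3)) | a₁ * R < ‖x‖ ∧ ‖x‖ < b₁ * R} := smul_shell_open hR a₁ b₁
  set D : ℝ≥0∞ := ENNReal.ofReal ((R ^ 3)⁻¹) ^ (1 / p.toReal) with hD
  have hD0 : D ≠ 0 := by
    rw [hD]; exact (ENNReal.rpow_pos (ENNReal.ofReal_pos.2 (by positivity)) ENNReal.ofReal_ne_top).ne'
  have hDtop : D ≠ ⊤ := ENNReal.rpow_ne_top_of_nonneg (by positivity) ENNReal.ofReal_ne_top
  have hD2 : ENNReal.ofReal ((R ^ 3)⁻¹) ^ (1 / (2 * p).toReal) = D ^ (1 / 2 : ℝ) := by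
    rw [hD, ← ENNReal.rpow_mul, ENNReal.toReal_mul, ENNReal.toReal_ofNat]
    congr 1
    field_simp
  -- the three norms after the change of variables
  set XP : ℝ≥0∞ := eLpNorm (fun x => P x - c' / R ^ 2) p
    (volume.restrict {x : (EuclideanSpace ℝ (Fin 3)) | a₂ * R ≤ ‖x‖ ∧ ‖x‖ ≤ b₂ * R}) with hXP
  set XU : ℝ≥0∞ := eLpNorm U p (volume.restrict {x : (EuclideanSpace ℝ (Fin 3)) | a₁ * R < ‖x‖ ∧ ‖x‖ < b₁ * R}) with hXU
  set XU2 : ℝ≥0∞ := eLpNorm U (2 * p) (volume.restrict {x : (EuclideanSpace ℝ (Fin 3)) | a₁ * R < ‖x‖ ∧ ‖x‖ < b₁ * R})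
    with hXU2
  have eP : eLpNorm (fun x => P' x - c') p (volume.restrict A₁) = ENNReal.ofReal (R ^ 2) * (D * XP) := by
    have hfun : (fun x => P' x - c') = (R ^ 2 : ℝ) • fun x => P (R • x) - c' / R ^ 2 := by
      funext x; simp only [hP', Pi.smul_apply, smul_eq_mul]; field_simp
    rw [hfun, eLpNorm_const_smul, eLpNorm_comp_smul_set (fun y => P y - c' / R ^ 2) hR hA₁m hp0 hptop,
      hAR, Real.enorm_eq_ofReal (by positivity)]
  have eU : eLpNorm U' p (volume.restrict K₁) = ENNReal.ofReal R * (D * XU) := by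
    have hfun : U' = (R : ℝ) • fun x => U (R • x) := rfl
    rw [hfun, eLpNorm_const_smul, eLpNorm_comp_smul_set U hR hK₁m hp0 hptop, hKR,
      Real.enorm_eq_ofReal hR.le]
  have eU2 : eLpNorm U' (2 * p) (volume.restrict K₁) ^ (2 : ℝ) =
      ENNReal.ofReal R ^ (2 : ℝ) * (D * XU2 ^ (2 : ℝ)) := by
    have hfun : U' = (R : ℝ) • fun x => U (R • x) := rfl
    rw [hfun, eLpNorm_const_smul, eLpNorm_comp_smul_set U hR hK₁m h2p0 h2ptop, hKR,
      Real.enorm_eq_ofReal hR.le, hD2, ENNReal.mul_rpow_of_nonneg _ _ (by norm_num),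
      ENNReal.mul_rpow_of_nonneg _ _ (by norm_num), ← ENNReal.rpow_mul]
    norm_num
    rw [hXU2]
  rw [eP, eU, eU2] at hc'
  -- cancel the common positive factor `R² D`
  have hR2 : ENNReal.ofReal (R ^ 2) ≠ 0 := (ENNReal.ofReal_pos.2 (by positivity)).ne'
  have hkey : XP * (ENNReal.ofReal (R ^ 2) * D) ≤
      C * (ENNReal.ofReal R⁻¹ * XU + XU2 ^ (2 : ℝ)) * (ENNReal.ofReal (R ^ 2) * D) := by
    have e1 : ENNReal.ofReal R = ENNReal.ofReal (R ^ 2) * ENNReal.ofReal R⁻¹ := by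
      rw [← ENNReal.ofReal_mul (by positivity)]; congr 1; field_simp
    have e2 : ENNReal.ofReal R ^ (2 : ℝ) = ENNReal.ofReal (R ^ 2) := by
      rw [ENNReal.ofReal_pow hR.le]; norm_num
    calc XP * (ENNReal.ofReal (R ^ 2) * D) = ENNReal.ofReal (R ^ 2) * (D * XP) := by ring
      _ ≤ C * (ENNReal.ofReal R * (D * XU) + ENNReal.ofReal R ^ (2 : ℝ) * (D * XU2 ^ (2 : ℝ))) := hc'
      _ = C * (ENNReal.ofReal R⁻¹ * XU + XU2 ^ (2 : ℝ)) * (ENNReal.ofReal (R ^ 2) * D) := by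
          rw [e2, e1]; ring
  exact (ENNReal.mul_le_mul_iff_left (mul_ne_zero hR2 hD0)
    (ENNReal.mul_ne_top ENNReal.ofReal_ne_top hDtop)).1 hkey

end Scaling

end Tsai2021

end Literature.Analysis.FluidPDE

end
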